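import Literature.NumberTheory.Sieve.BatemanHornMertensProduct
import Literature.NumberTheory.LFunctions.MertensPrimeIdeals
import Literature.Analysis.Asymptotics.KaramataTauberianMeasure
import Literature.NumberTheory.Sieve.SelbergSumLowerBound
import Literature.NumberTheory.Sieve.SieveFrameworkProofs
import Literature.NumberTheory.Sieve.DivisorPowerSums
import Mathlib.NumberTheory.LSeries.SumCoeff
import Mathlib.NumberTheory.LSeries.RiemannZeta
import Mathlib.NumberTheory.EulerProduct.Basic
import Mathlib.Analysis.Normed.Group.Tannery
import Mathlib.Analysis.SpecialFunctions.Log.Summable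
import HarnessLib

/-!
# Selberg's upper bound for a Bateman–Horn system at the parity constant `2^k k!`

Topic `Literature/NumberTheory/Sieve`. Everything in this file is PROVED (no named fact, no
`sorry`).

Part A (this part): the mean value of the completely multiplicative minorant of Selberg's sum for
a Bateman–Horn system `f = (f₁,…,f_k)`. Let `ω(p) = ω_f(p)` and let `f̃` be the completely
multiplicative function with `f̃(p) = ω(p)/p`. We prove, by Karamata's Tauberian theorem
(tree `Literature.Analysis.Asymptotics.karamata_tauberian_measure_of_tendsto_rpow_mul`) applied to the
Dirichlet series `∑ f̃(n) n^{-δ} = ∏_p (1 − ω(p) p^{-1-δ})^{-1}`, the residue of `ζ` (Mathlib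
`tendsto_sub_mul_tsum_nat_rpow`), Mertens/Bateman–Horn convergence of the singular series
(`IsBatemanHornSystem.hasBatemanHornConst_holds`, `AZFG2020_tendsto_sum_sub_omega_div_holds`) and
Hardy–Wright's Abelian argument (`Mertens.tendsto_mul_integral_rpow_of_tendsto`), that
`∑_{n ≤ x} f̃(n) ∼ (log x)^k / (k! C(f))` where `C(f) = batemanHornConst f` — the `G(z)`-asymptotic
of Greaves, *Sieves in Number Theory*, Thm 2.2.2 / Halberstam–Richert Lemma 5.4 in the form needed
for the Bateman–Horn application (Greaves §2.3.3 Thm 4).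

## References
* G. Greaves, *Sieves in Number Theory*, Springer (2001), §2.2.2 Theorem 2 and §2.3.3 Theorem 4.
  [Greaves2001]
* H. G. Diamond, H. Halberstam, W. F. Galway, *A Higher-Dimensional Sieve Method*, CUP (2008),
  Thm. 5.6, Cor. 5.7, Example 5.8 (5.47). [DiamondHalberstamGalway2008]
-/

open Finset Filter Topology Polynomial MeasureTheory

namespace Literature.NumberTheory.Sieve

namespace BatemanHornSelberg

/-! ### Completely multiplicative functions from their values at the primes -/

/-- `cm a n = ∏_{p^m ∥ n} a(p)^m` (`n ≥ 1`), `cm a 0 = 0`: the completely multiplicative function with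
values `a(p)` at the primes. [folklore] -/
private noncomputable def cm (a : ℕ → ℝ) (n : ℕ) : ℝ :=
  if n = 0 then 0 else n.factorization.prod fun p m => a p ^ m

/-- Helper `cm_zero` (see the module docstring). [folklore] -/
private theorem cm_zero (a : ℕ → ℝ) : cm a 0 = 0 := by simp [cm]

/-- Helper `cm_one` (see the module docstring). [folklore] -/
private theorem cm_one (a : ℕ → ℝ) : cm a 1 = 1 := by simp [cm]

/-- Helper `cm_mul` (see the module docstring). [folklore] -/
private theorem cm_mul (a : ℕ → ℝ) (m n : ℕ) : cm a (m * n) = cm a m * cm a n := by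
  rcases eq_or_ne m 0 with rfl | hm
  · simp [cm]
  rcases eq_or_ne n 0 with rfl | hn
  · simp [cm]
  simp only [cm, hm, hn, mul_eq_zero, or_self, if_false]
  rw [Nat.factorization_mul hm hn, Finsupp.prod_add_index']
  · intro p; exact pow_zero _
  · intro p m₁ m₂; exact pow_add _ _ _

/-- Helper `cm_prime` (see the module docstring). [folklore] -/
private theorem cm_prime (a : ℕ → ℝ) {p : ℕ} (hp : p.Prime) : cm a p = a p := by
  rw [cm, if_neg hp.ne_zero, hp.factorization, Finsupp.prod_single_index] <;> simp

/-- Helper `cm_nonneg` (see the module docstring). [folklore] -/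
private theorem cm_nonneg {a : ℕ → ℝ} (ha : ∀ p, 0 ≤ a p) (n : ℕ) : 0 ≤ cm a n := by
  rw [cm]
  split_ifs
  · exact le_rfl
  · exact Finset.prod_nonneg fun p _ => pow_nonneg (ha p) _

/-- `cm a` as a monoid-with-zero homomorphism `ℕ →*₀ ℝ`. [folklore] -/
private noncomputable def cmHom (a : ℕ → ℝ) : ℕ →*₀ ℝ where
  toFun := cm a
  map_zero' := cm_zero a
  map_one' := cm_one a
  map_mul' := cm_mul a

/-- Helper `cmHom_apply` (see the module docstring). [folklore] -/
private theorem cmHom_apply (a : ℕ → ℝ) (n : ℕ) : cmHom a n = cm a n := rfl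

/-- Twisting by `n^{-δ}`: `cm (p ↦ a(p) p^{-δ}) n = cm a n · n^{-δ}`. [folklore] -/
private theorem cm_mul_rpow (a : ℕ → ℝ) (δ : ℝ) (n : ℕ) :
    cm (fun p => a p * (p : ℝ) ^ (-δ)) n = cm a n * (n : ℝ) ^ (-δ) := by
  induction n using Nat.recOnMul with
  | zero => simp [cm_zero]
  | one => simp [cm_one]
  | prime p hp => rw [cm_prime _ hp, cm_prime _ hp]
  | mul x y hx hy =>
      rw [cm_mul, cm_mul, hx, hy, Nat.cast_mul,
        Real.mul_rpow (Nat.cast_nonneg x) (Nat.cast_nonneg y)]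
      ring

/-! ### The local densities of a Bateman–Horn system -/

variable {k : ℕ}

/-- `dens f p = ω_f(p)/p`. [folklore] -/
private noncomputable def dens (f : Fin k → ℤ[X]) (p : ℕ) : ℝ := (polyRootCountMod f p : ℝ) / p

/-- Helper `dens_nonneg` (see the module docstring). [folklore] -/
private theorem dens_nonneg (f : Fin k → ℤ[X]) (p : ℕ) : 0 ≤ dens f p := by
  rw [dens]; positivity

/-- `ω_f(p) ≤ p − 1` at primes, so `dens f p ≤ 1 − 1/p < 1`. [folklore] -/
private theorem dens_le_one_sub {f : Fin k → ℤ[X]} (hf : IsBatemanHornSystem f) {p : ℕ}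
    (hp : p.Prime) : dens f p ≤ 1 - 1 / p := by
  have hp0 : (0 : ℝ) < p := by exact_mod_cast hp.pos
  have h : (polyRootCountMod f p : ℝ) + 1 ≤ p := by
    exact_mod_cast Nat.succ_le_of_lt (hf.hasNoFixedPrimeDivisor p hp)
  rw [dens, div_le_iff₀ hp0, sub_mul, one_mul, div_mul_cancel₀ _ hp0.ne']
  linarith

/-- Helper `dens_lt_one` (see the module docstring). [folklore] -/
private theorem dens_lt_one {f : Fin k → ℤ[X]} (hf : IsBatemanHornSystem f) {p : ℕ}
    (hp : p.Prime) : dens f p < 1 := by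
  have h := dens_le_one_sub hf hp
  have : (0 : ℝ) < 1 / p := by have := hp.pos; positivity
  linarith

/-- The total degree `D = ∑ deg fᵢ`. [folklore] -/
private noncomputable def totDeg (f : Fin k → ℤ[X]) : ℕ := ∑ i, (f i).natDegree

/-- `ω_f(p) ≤ D` at primes. [folklore] -/
private theorem rootCount_le_totDeg {f : Fin k → ℤ[X]} (hf : IsBatemanHornSystem f) {p : ℕ}
    (hp : p.Prime) : (polyRootCountMod f p : ℝ) ≤ totDeg f := by
  have h : polyRootCountMod f p ≤ totDeg f := by
    rw [PolyPrimeCountBrun.polyRootCountMod_eq_single_prod]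
    refine (PolyPrimeCountBrun.polyRootCountMod_single_le_natDegree_of_lt hp ?_).trans ?_
    · rw [← PolyPrimeCountBrun.polyRootCountMod_eq_single_prod]
      exact hf.hasNoFixedPrimeDivisor p hp
    · exact natDegree_prod_le _ _
  exact_mod_cast h

/-- `dens f p ≤ D/p` at primes. [folklore] -/
private theorem dens_le_div {f : Fin k → ℤ[X]} (hf : IsBatemanHornSystem f) {p : ℕ}
    (hp : p.Prime) : dens f p ≤ totDeg f / p := by
  rw [dens]
  exact div_le_div_of_nonneg_right (rootCount_le_totDeg hf hp) (Nat.cast_nonneg _)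

/-- For `p > 2D`: `dens f p ≤ 1/2`. [folklore] -/
private theorem dens_le_half {f : Fin k → ℤ[X]} (hf : IsBatemanHornSystem f) {p : ℕ}
    (hp : p.Prime) (hpD : 2 * totDeg f < p) : dens f p ≤ 1 / 2 := by
  have hp0 : (0 : ℝ) < p := by exact_mod_cast hp.pos
  have h2 : (2 * totDeg f : ℝ) < p := by exact_mod_cast hpD
  calc dens f p ≤ totDeg f / p := dens_le_div hf hp
    _ ≤ 1 / 2 := by rw [div_le_iff₀ hp0]; linarith

/-! ### An elementary logarithmic inequality -/

/-- For `0 ≤ t ≤ 1/2`: `0 ≤ −log(1 − t) − t ≤ 2t²`. [folklore] -/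
private theorem neg_log_one_sub_sub_bounds {t : ℝ} (ht0 : 0 ≤ t) (ht : t ≤ 1 / 2) :
    0 ≤ -Real.log (1 - t) - t ∧ -Real.log (1 - t) - t ≤ 2 * t ^ 2 := by
  have h1t : 0 < 1 - t := by linarith
  constructor
  · linarith [Real.log_le_sub_one_of_pos h1t]
  · have hT := Real.abs_log_sub_add_sum_range_le (show |t| < 1 by rw [abs_of_nonneg ht0]; linarith) 1
    rw [abs_of_nonneg ht0] at hT
    norm_num [Finset.sum_range_succ] at hT
    -- hT : |t + log (1 - t)| ≤ t ^ 2 / (1 - t)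
    have h2 : t ^ 2 / (1 - t) ≤ 2 * t ^ 2 := by
      rw [div_le_iff₀ h1t]; nlinarith [sq_nonneg t]
    have h3 := (abs_le.mp (hT.trans h2)).1
    linarith

/-! ### The summands `u_p(δ) = −log(1 − ω(p)p^{-1-δ}) + k log(1 − p^{-1-δ})` and their main terms -/

variable (f : Fin k → ℤ[X])

/-- `c(n) = (ω(n) − k)/n` at primes, `0` elsewhere. [folklore] -/
private noncomputable def cfun (n : ℕ) : ℝ :=
  if n.Prime then ((polyRootCountMod f n : ℝ) - k) / n else 0

/-- `u(n, δ) = −log(1 − dens(n) n^{-δ}) + k log(1 − n^{-(1+δ)})` at primes, `0` elsewhere. [folklore] -/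
private noncomputable def ufun (n : ℕ) (δ : ℝ) : ℝ :=
  if n.Prime then
    -Real.log (1 - dens f n * (n : ℝ) ^ (-δ)) + k * Real.log (1 - (n : ℝ) ^ (-(1 + δ)))
  else 0

/-- `v(n, δ) = u(n, δ) − c(n) n^{-δ}` (the second-order remainder). [folklore] -/
private noncomputable def vfun (n : ℕ) (δ : ℝ) : ℝ := ufun f n δ - cfun f n * (n : ℝ) ^ (-δ)

variable {f}

/-- Helper `cfun_of_not_prime` (see the module docstring). [folklore] -/
private theorem cfun_of_not_prime {n : ℕ} (hn : ¬ n.Prime) : cfun f n = 0 := by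
  rw [cfun, if_neg hn]

/-- Helper `ufun_of_not_prime` (see the module docstring). [folklore] -/
private theorem ufun_of_not_prime {n : ℕ} (hn : ¬ n.Prime) (δ : ℝ) : ufun f n δ = 0 := by
  rw [ufun, if_neg hn]

/-- Helper `vfun_of_not_prime` (see the module docstring). [folklore] -/
private theorem vfun_of_not_prime {n : ℕ} (hn : ¬ n.Prime) (δ : ℝ) : vfun f n δ = 0 := by
  rw [vfun, ufun_of_not_prime hn, cfun_of_not_prime hn, zero_mul, sub_zero]

/-- `|c(p)| ≤ (D + k)/p`. [folklore] -/
private theorem abs_cfun_le (hf : IsBatemanHornSystem f) (n : ℕ) :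
    |cfun f n| ≤ (totDeg f + k) / n := by
  by_cases hn : n.Prime
  · rw [cfun, if_pos hn, abs_div, Nat.abs_cast]
    refine div_le_div_of_nonneg_right ?_ (Nat.cast_nonneg _)
    have h1 := rootCount_le_totDeg hf hn
    have h0 : (0 : ℝ) ≤ polyRootCountMod f n := Nat.cast_nonneg _
    rw [abs_le]; constructor <;> linarith
  · rw [cfun_of_not_prime hn, abs_zero]; positivity

/-- At a prime `p`, with `t₁ = dens(p) p^{-δ}` and `t₂ = p^{-(1+δ)}`:
`v(p, δ) = (−log(1−t₁) − t₁) + k (log(1 − t₂) + t₂)` (since `c(p) p^{-δ} = t₁ − k t₂`). [folklore] -/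
private theorem vfun_prime_eq {p : ℕ} (hp : p.Prime) (δ : ℝ) :
    vfun f p δ = (-Real.log (1 - dens f p * (p : ℝ) ^ (-δ)) - dens f p * (p : ℝ) ^ (-δ)) +
      k * (Real.log (1 - (p : ℝ) ^ (-(1 + δ))) + (p : ℝ) ^ (-(1 + δ))) := by
  have hp0 : (0 : ℝ) < p := by exact_mod_cast hp.pos
  have hsplit : (p : ℝ) ^ (-(1 + δ)) = (p : ℝ)⁻¹ * (p : ℝ) ^ (-δ) := by
    rw [neg_add, Real.rpow_add hp0, Real.rpow_neg_one]
  rw [vfun, ufun, if_pos hp, cfun, if_pos hp, dens, hsplit]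
  field_simp
  ring

/-- For a prime `p > 2D` and `δ ≥ 0`: `|v(p, δ)| ≤ (D² + k)/p²`. [folklore] -/
private theorem abs_vfun_le_of_large (hf : IsBatemanHornSystem f) {p : ℕ} (hp : p.Prime)
    (hpD : 2 * totDeg f < p) {δ : ℝ} (hδ : 0 ≤ δ) :
    |vfun f p δ| ≤ 2 * ((totDeg f : ℝ) ^ 2 + k) / (p : ℝ) ^ 2 := by
  have hp0 : (0 : ℝ) < p := by exact_mod_cast hp.pos
  have hp2 : (2 : ℝ) ≤ p := by exact_mod_cast hp.two_le
  set t₁ : ℝ := dens f p * (p : ℝ) ^ (-δ) with ht₁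
  set t₂ : ℝ := (p : ℝ) ^ (-(1 + δ)) with ht₂
  have hpδ : (p : ℝ) ^ (-δ) ≤ 1 :=
    Real.rpow_le_one_of_one_le_of_nonpos (by linarith) (by linarith)
  have hpδ0 : 0 ≤ (p : ℝ) ^ (-δ) := Real.rpow_nonneg hp0.le _
  have ht₁0 : 0 ≤ t₁ := mul_nonneg (dens_nonneg f p) hpδ0
  have ht₁le : t₁ ≤ dens f p := by
    calc t₁ ≤ dens f p * 1 := mul_le_mul_of_nonneg_left hpδ (dens_nonneg f p)
      _ = dens f p := mul_one _
  have ht₁h : t₁ ≤ 1 / 2 := ht₁le.trans (dens_le_half hf hp hpD)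
  have ht₁D : t₁ ≤ totDeg f / p := ht₁le.trans (dens_le_div hf hp)
  have ht₂0 : 0 ≤ t₂ := Real.rpow_nonneg hp0.le _
  have ht₂le : t₂ ≤ 1 / p := by
    rw [ht₂, neg_add, Real.rpow_add hp0, Real.rpow_neg_one, one_div]
    exact mul_le_of_le_one_right (inv_nonneg.mpr hp0.le) hpδ
  have ht₂h : t₂ ≤ 1 / 2 := ht₂le.trans (one_div_le_one_div_of_le (by norm_num) hp2)
  obtain ⟨h1a, h1b⟩ := neg_log_one_sub_sub_bounds ht₁0 ht₁h
  obtain ⟨h2a, h2b⟩ := neg_log_one_sub_sub_bounds ht₂0 ht₂h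
  rw [vfun_prime_eq hp δ, ← ht₁, ← ht₂]
  have hsq1 : t₁ ^ 2 ≤ (totDeg f : ℝ) ^ 2 / (p : ℝ) ^ 2 := by
    rw [← div_pow]; exact pow_le_pow_left₀ ht₁0 ht₁D 2
  have hsq2 : t₂ ^ 2 ≤ 1 / (p : ℝ) ^ 2 := by
    rw [← one_div_pow]; exact pow_le_pow_left₀ ht₂0 ht₂le 2
  have hk0 : (0 : ℝ) ≤ k := Nat.cast_nonneg _
  have e : 2 * ((totDeg f : ℝ) ^ 2 + k) / (p : ℝ) ^ 2 =
      2 * ((totDeg f : ℝ) ^ 2 / (p : ℝ) ^ 2) + k * (2 * (1 / (p : ℝ) ^ 2)) := by ring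
  have hA : 0 ≤ (totDeg f : ℝ) ^ 2 / (p : ℝ) ^ 2 := by positivity
  have hB : 0 ≤ k * (2 * (1 / (p : ℝ) ^ 2)) := by positivity
  -- `-k·2t₂² ≤ k (log(1-t₂) + t₂) ≤ 0`
  have hk1 : k * (Real.log (1 - t₂) + t₂) ≤ 0 := by
    have : Real.log (1 - t₂) + t₂ ≤ 0 := by linarith
    exact mul_nonpos_of_nonneg_of_nonpos hk0 this
  have hk2 : -(k * (2 * (1 / (p : ℝ) ^ 2))) ≤ k * (Real.log (1 - t₂) + t₂) := by
    have : -(2 * (1 / (p : ℝ) ^ 2)) ≤ Real.log (1 - t₂) + t₂ := by linarith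
    have := mul_le_mul_of_nonneg_left this hk0
    linarith
  rw [e, abs_le]
  constructor
  · linarith
  · linarith

/-- A bound valid at every prime `p` and `δ ≥ 0`:
`|v(p, δ)| ≤ −log(1 − dens p) + dens p + k (log 2 + 1)`. [folklore] -/
private theorem abs_vfun_le_of_small (hf : IsBatemanHornSystem f) {p : ℕ} (hp : p.Prime)
    {δ : ℝ} (hδ : 0 ≤ δ) :
    |vfun f p δ| ≤ -Real.log (1 - dens f p) + dens f p + k * (Real.log 2 + 1) := by
  have hp0 : (0 : ℝ) < p := by exact_mod_cast hp.pos
  have hp2 : (2 : ℝ) ≤ p := by exact_mod_cast hp.two_le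
  set t₁ : ℝ := dens f p * (p : ℝ) ^ (-δ) with ht₁
  set t₂ : ℝ := (p : ℝ) ^ (-(1 + δ)) with ht₂
  have hpδ : (p : ℝ) ^ (-δ) ≤ 1 :=
    Real.rpow_le_one_of_one_le_of_nonpos (by linarith) (by linarith)
  have hpδ0 : 0 ≤ (p : ℝ) ^ (-δ) := Real.rpow_nonneg hp0.le _
  have hd1 := dens_lt_one hf hp
  have ht₁0 : 0 ≤ t₁ := mul_nonneg (dens_nonneg f p) hpδ0
  have ht₁le : t₁ ≤ dens f p := by
    calc t₁ ≤ dens f p * 1 := mul_le_mul_of_nonneg_left hpδ (dens_nonneg f p)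
      _ = dens f p := mul_one _
  have ht₂0 : 0 ≤ t₂ := Real.rpow_nonneg hp0.le _
  have ht₂le : t₂ ≤ 1 / p := by
    rw [ht₂, neg_add, Real.rpow_add hp0, Real.rpow_neg_one, one_div]
    exact mul_le_of_le_one_right (inv_nonneg.mpr hp0.le) hpδ
  have ht₂h : t₂ ≤ 1 / 2 := ht₂le.trans (one_div_le_one_div_of_le (by norm_num) hp2)
  -- `0 ≤ -log(1 - t₁) ≤ -log(1 - dens)` and `0 ≤ -log(1-t₂) ≤ log 2`
  have hA0 : 0 ≤ -Real.log (1 - t₁) := by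
    have := Real.log_le_sub_one_of_pos (show 0 < 1 - t₁ by linarith); linarith
  have hA1 : -Real.log (1 - t₁) ≤ -Real.log (1 - dens f p) := by
    have := Real.log_le_log (by linarith : 0 < 1 - dens f p) (by linarith : 1 - dens f p ≤ 1 - t₁)
    linarith
  have hB0 : 0 ≤ -Real.log (1 - t₂) := by
    have := Real.log_le_sub_one_of_pos (show 0 < 1 - t₂ by linarith); linarith
  have hB1 : -Real.log (1 - t₂) ≤ Real.log 2 := by
    have := Real.log_le_log (by norm_num : (0 : ℝ) < 1 / 2) (by linarith : 1 / 2 ≤ 1 - t₂)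
    have e : Real.log (1 / 2 : ℝ) = -Real.log 2 := by
      rw [one_div, Real.log_inv]
    linarith
  have hk0 : (0 : ℝ) ≤ k := Nat.cast_nonneg _
  rw [vfun_prime_eq hp δ, ← ht₁, ← ht₂, abs_le]
  constructor
  · have h1 : -Real.log (1 - t₁) - t₁ ≥ -dens f p := by linarith
    have h2 : k * (Real.log (1 - t₂) + t₂) ≥ -(k * (Real.log 2 + 1)) := by
      have : Real.log (1 - t₂) + t₂ ≥ -(Real.log 2 + 1) := by linarith
      nlinarith
    nlinarith [dens_nonneg f p, Real.log_pos one_lt_two]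
  · have h1 : -Real.log (1 - t₁) - t₁ ≤ -Real.log (1 - dens f p) := by linarith
    have h2 : k * (Real.log (1 - t₂) + t₂) ≤ k * (Real.log 2 + 1) := by
      have : Real.log (1 - t₂) + t₂ ≤ Real.log 2 + 1 := by
        have : t₂ ≤ 1 := by linarith
        linarith
      nlinarith
    linarith [dens_nonneg f p]

/-- The dominating function: `M(p) = (D² + k)/p²` for primes `p > 2D`, the crude bound for the primes
`p ≤ 2D`, and `0` off the primes. [folklore] -/
private noncomputable def vbound (f : Fin k → ℤ[X]) (n : ℕ) : ℝ :=
  if n.Prime then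
    (if 2 * totDeg f < n then 2 * ((totDeg f : ℝ) ^ 2 + k) / (n : ℝ) ^ 2
      else -Real.log (1 - dens f n) + dens f n + k * (Real.log 2 + 1))
  else 0

/-- Helper `abs_vfun_le_vbound` (see the module docstring). [folklore] -/
private theorem abs_vfun_le_vbound (hf : IsBatemanHornSystem f) (n : ℕ) {δ : ℝ} (hδ : 0 ≤ δ) :
    |vfun f n δ| ≤ vbound f n := by
  by_cases hn : n.Prime
  · rw [vbound, if_pos hn]
    split_ifs with hD
    · exact abs_vfun_le_of_large hf hn hD hδ
    · exact abs_vfun_le_of_small hf hn hδ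
  · rw [vfun_of_not_prime hn, vbound, if_neg hn, abs_zero]

/-- Helper `summable_vbound` (see the module docstring). [folklore] -/
private theorem summable_vbound (f : Fin k → ℤ[X]) : Summable (vbound f) := by
  -- `vbound ≤ (D²+k)/n² + (finite part)`
  set F : ℕ → ℝ := fun n => if n ≤ 2 * totDeg f then |vbound f n| else 0 with hF
  have hFsupp : ∀ n ∉ Finset.range (2 * totDeg f + 1), F n = 0 := by
    intro n hn
    rw [Finset.mem_range, not_lt] at hn
    rw [hF]; simp only
    rw [if_neg (by omega)]
  have hFsum : Summable F := summable_of_ne_finset_zero hFsupp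
  have hG : Summable fun n : ℕ => 2 * ((totDeg f : ℝ) ^ 2 + k) / (n : ℝ) ^ 2 := by
    have := (Real.summable_one_div_nat_pow.mpr one_lt_two).mul_left (2 * ((totDeg f : ℝ) ^ 2 + k))
    refine this.congr fun n => ?_
    ring
  refine (hFsum.add hG).of_norm_bounded fun n => ?_
  rw [Real.norm_eq_abs]
  by_cases hn : n.Prime
  · rw [vbound, if_pos hn]
    split_ifs with hD
    · have h0 : 0 ≤ 2 * ((totDeg f : ℝ) ^ 2 + k) / (n : ℝ) ^ 2 := by positivity
      rw [abs_of_nonneg h0, hF]; simp only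
      rw [if_neg (by omega)]
      simp
    · rw [hF]; simp only
      rw [if_pos (by omega), vbound, if_pos hn, if_neg hD]
      have h0 : 0 ≤ 2 * ((totDeg f : ℝ) ^ 2 + k) / (n : ℝ) ^ 2 := by positivity
      linarith
  · rw [vbound, if_neg hn, abs_zero]
    have h1 : 0 ≤ F n := by rw [hF]; simp only; split_ifs <;> simp
    have h0 : 0 ≤ 2 * ((totDeg f : ℝ) ^ 2 + k) / (n : ℝ) ^ 2 := by positivity
    linarith

/-- Continuity of `δ ↦ v(n, δ)` at `0` (from the right). [folklore] -/
private theorem tendsto_vfun (hf : IsBatemanHornSystem f) (n : ℕ) :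
    Tendsto (fun δ : ℝ => vfun f n δ) (𝓝[>] 0) (𝓝 (vfun f n 0)) := by
  by_cases hn : n.Prime
  · have hn0 : (n : ℝ) ≠ 0 := by exact_mod_cast hn.ne_zero
    have hn2 : (2 : ℝ) ≤ n := by exact_mod_cast hn.two_le
    have h1 : ContinuousAt (fun δ : ℝ => (n : ℝ) ^ (-δ)) 0 :=
      (Real.continuousAt_const_rpow hn0).comp continuous_neg.continuousAt
    have h2 : ContinuousAt (fun δ : ℝ => (n : ℝ) ^ (-(1 + δ))) 0 :=
      (Real.continuousAt_const_rpow hn0).comp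
        (continuous_const.add continuous_id).neg.continuousAt
    have hd1 := dens_lt_one hf hn
    have hpos1 : 0 < 1 - dens f n * (n : ℝ) ^ (-(0 : ℝ)) := by
      rw [neg_zero, Real.rpow_zero, mul_one]; linarith
    have hpos2 : 0 < 1 - (n : ℝ) ^ (-(1 + (0 : ℝ))) := by
      rw [add_zero, Real.rpow_neg_one]
      have : (n : ℝ)⁻¹ ≤ 2⁻¹ := by rw [inv_le_inv₀ (by linarith) (by norm_num)]; exact hn2
      linarith [this, (by norm_num : (2 : ℝ)⁻¹ = 1 / 2)]
    have h1' : ContinuousAt (fun δ : ℝ => 1 - dens f n * (n : ℝ) ^ (-δ)) 0 :=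
      continuousAt_const.sub (continuousAt_const.mul h1)
    have h2' : ContinuousAt (fun δ : ℝ => 1 - (n : ℝ) ^ (-(1 + δ))) 0 :=
      continuousAt_const.sub h2
    have hlog1 : ContinuousAt (fun δ : ℝ => Real.log (1 - dens f n * (n : ℝ) ^ (-δ))) 0 :=
      h1'.log hpos1.ne'
    have hlog2 : ContinuousAt (fun δ : ℝ => Real.log (1 - (n : ℝ) ^ (-(1 + δ)))) 0 :=
      h2'.log hpos2.ne'
    have e : (fun δ : ℝ => vfun f n δ) = fun δ =>
        (-Real.log (1 - dens f n * (n : ℝ) ^ (-δ)) + k * Real.log (1 - (n : ℝ) ^ (-(1 + δ)))) -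
          cfun f n * (n : ℝ) ^ (-δ) := by
      funext δ
      simp only [vfun, ufun, if_pos hn]
    have hcont : ContinuousAt (fun δ : ℝ => vfun f n δ) 0 := by
      rw [e]
      exact (hlog1.neg.add (continuousAt_const.mul hlog2)).sub (continuousAt_const.mul h1)
    exact hcont.tendsto.mono_left nhdsWithin_le_nhds
  · simp only [vfun_of_not_prime hn]
    exact tendsto_const_nhds

/-- **`V(δ) = ∑_p v(p, δ) → V(0)` as `δ → 0⁺`** (dominated convergence). [folklore] -/
private theorem tendsto_tsum_vfun (hf : IsBatemanHornSystem f) :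
    Tendsto (fun δ : ℝ => ∑' n, vfun f n δ) (𝓝[>] 0) (𝓝 (∑' n, vfun f n 0)) := by
  refine tendsto_tsum_of_dominated_convergence (summable_vbound f) (tendsto_vfun hf) ?_
  filter_upwards [self_mem_nhdsWithin] with δ hδ
  intro n
  rw [Real.norm_eq_abs]
  exact abs_vfun_le_vbound hf n (le_of_lt hδ)

/-- Helper `summable_vfun` (see the module docstring). [folklore] -/
private theorem summable_vfun (hf : IsBatemanHornSystem f) {δ : ℝ} (hδ : 0 ≤ δ) :
    Summable fun n => vfun f n δ :=
  (summable_vbound f).of_norm_bounded fun n => by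
    rw [Real.norm_eq_abs]; exact abs_vfun_le_vbound hf n hδ

/-! ### Range sums versus sums over `Nat.primesLE` -/

/-- Helper `sum_range_succ_eq_sum_primesLE` (see the module docstring). [folklore] -/
private theorem sum_range_succ_eq_sum_primesLE {g : ℕ → ℝ} (hg : ∀ n, ¬ n.Prime → g n = 0)
    (N : ℕ) : ∑ n ∈ range (N + 1), g n = ∑ p ∈ Nat.primesLE N, g p := by
  rw [Nat.primesLE_eq_filter_range, Finset.sum_filter]
  refine sum_congr rfl fun n _ => ?_
  split_ifs with h
  · rfl
  · exact hg n h

/-- Helper `sum_Icc_eq_sum_primesLE` (see the module docstring). [folklore] -/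
private theorem sum_Icc_eq_sum_primesLE {g : ℕ → ℝ} (hg : ∀ n, ¬ n.Prime → g n = 0)
    (N : ℕ) : ∑ n ∈ Icc 1 N, g n = ∑ p ∈ Nat.primesLE N, g p := by
  rw [← sum_range_succ_eq_sum_primesLE hg N]
  refine Finset.sum_subset (fun n hn => ?_) (fun n hn hn' => ?_)
  · rw [mem_Icc] at hn; rw [mem_range]; omega
  · rw [mem_range] at hn; rw [mem_Icc] at hn'
    have : n = 0 := by omega
    rw [this]; exact hg 0 Nat.not_prime_zero

/-! ### The main terms: `H(δ) = ∑_p c(p) p^{-δ} → L_c` (Hardy–Wright's Abelian argument) -/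

/-- The summatory function `C(x) = ∑_{1 ≤ n ≤ x} c(n) = ∑_{p ≤ x} (ω(p) − k)/p`. [folklore] -/
private noncomputable def csum (f : Fin k → ℤ[X]) (x : ℝ) : ℝ := ∑ n ∈ Icc 1 ⌊x⌋₊, cfun f n

/-- `∑_{p ≤ x} (ω(p) − k)/p` converges (Bateman–Horn / AZFG (5.4.4)). [folklore] -/
private theorem exists_tendsto_csum (hf : IsBatemanHornSystem f) :
    ∃ Lc : ℝ, Tendsto (fun N : ℕ => ∑ p ∈ Nat.primesLE N, cfun f p) atTop (𝓝 Lc) ∧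
      Tendsto (csum f) atTop (𝓝 Lc) := by
  obtain ⟨L, hL⟩ := AZFG2020_tendsto_sum_sub_omega_div_holds k f hf
  have hnat : Tendsto (fun N : ℕ => ∑ p ∈ Nat.primesLE N, cfun f p) atTop (𝓝 (-L)) := by
    refine hL.neg.congr fun N => ?_
    rw [← sum_neg_distrib]
    refine sum_congr rfl fun p hp => ?_
    rw [cfun, if_pos (Nat.prime_of_mem_primesLE hp)]
    ring
  refine ⟨-L, hnat, ?_⟩
  have h2 := hnat.comp (tendsto_nat_floor_atTop : Tendsto (fun x : ℝ => ⌊x⌋₊) atTop atTop)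
  refine h2.congr fun x => ?_
  simp only [Function.comp, csum]
  exact (sum_Icc_eq_sum_primesLE (fun n hn => cfun_of_not_prime hn) _).symm

/-- `|C(x)| ≤ (D + k)(1 + log x)` for `x ≥ 1`. [folklore] -/
private theorem abs_csum_le (hf : IsBatemanHornSystem f) {x : ℝ} (hx : 1 ≤ x) :
    |csum f x| ≤ (totDeg f + k) * (1 + Real.log x) := by
  have hx0 : 0 < x := by linarith
  set N := ⌊x⌋₊ with hN
  have hN1 : 1 ≤ N := Nat.le_floor (by exact_mod_cast hx)
  have hharm : ∑ i ∈ Icc 1 N, (i : ℝ)⁻¹ ≤ 1 + Real.log N := by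
    have := harmonic_le_one_add_log N
    simp_rw [harmonic_eq_sum_Icc, Rat.cast_sum, Rat.cast_inv, Rat.cast_natCast] at this
    exact this
  have hlogN : Real.log N ≤ Real.log x :=
    Real.log_le_log (by exact_mod_cast hN1) (Nat.floor_le hx0.le)
  have hDk : (0 : ℝ) ≤ totDeg f + k := by positivity
  calc |csum f x| ≤ ∑ n ∈ Icc 1 N, |cfun f n| := abs_sum_le_sum_abs _ _
    _ ≤ ∑ n ∈ Icc 1 N, ((totDeg f : ℝ) + k) / (n : ℝ) := sum_le_sum fun n _ => abs_cfun_le hf n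
    _ = (totDeg f + k) * ∑ i ∈ Icc 1 N, (i : ℝ)⁻¹ := by
        rw [mul_sum]; exact sum_congr rfl fun n _ => by rw [div_eq_mul_inv]
    _ ≤ (totDeg f + k) * (1 + Real.log N) := mul_le_mul_of_nonneg_left hharm hDk
    _ ≤ (totDeg f + k) * (1 + Real.log x) := by gcongr

/-- Helper `measurable_csum` (see the module docstring). [folklore] -/
private theorem measurable_csum (f : Fin k → ℤ[X]) : Measurable (csum f) :=
  (measurable_from_nat (f := fun N : ℕ => ∑ n ∈ Icc 1 N, cfun f n)).comp Nat.measurable_floor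

/-- **`H(δ) = ∑_n c(n) n^{-δ} = δ ∫_1^∞ C(x) x^{-δ-1} dx`** for `δ > 0`, and the series converges
(partial summation, Mathlib `LSeries_eq_mul_integral'`, made real).
[cite: MontgomeryVaughan2007, §1.2, Thm. 1.3] -/
private theorem hasSum_cfun_rpow (hf : IsBatemanHornSystem f) {σ : ℝ} (hσ : 0 < σ) :
    HasSum (fun n : ℕ => cfun f n * (n : ℝ) ^ (-σ))
      (σ * ∫ x in Set.Ioi (1 : ℝ), csum f x * x ^ (-(σ + 1))) := by
  set g : ℕ → ℂ := fun n => (cfun f n : ℂ) with hg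
  have hr : (0 : ℝ) ≤ σ / 2 := by linarith
  have hDk : (0 : ℝ) ≤ totDeg f + k := by positivity
  have hO : (fun n : ℕ => ∑ m ∈ Icc 1 n, ‖g m‖) =O[atTop] fun n : ℕ => (n : ℝ) ^ (σ / 2) := by
    refine Asymptotics.IsBigO.of_bound ((totDeg f + k) * (1 + 2 / σ)) ?_
    filter_upwards [eventually_ge_atTop 1] with n hn
    have hn1 : (1 : ℝ) ≤ n := by exact_mod_cast hn
    have hnorm : ∀ m, ‖g m‖ = |cfun f m| := fun m => by
      rw [hg]; simp only [Complex.norm_real, Real.norm_eq_abs]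
    simp only [hnorm]
    have hsum0 : 0 ≤ ∑ m ∈ Icc 1 n, |cfun f m| := sum_nonneg fun m _ => abs_nonneg _
    rw [Real.norm_of_nonneg hsum0, Real.norm_of_nonneg (by positivity)]
    have hharm : ∑ i ∈ Icc 1 n, (i : ℝ)⁻¹ ≤ 1 + Real.log n := by
      have := harmonic_le_one_add_log n
      simp_rw [harmonic_eq_sum_Icc, Rat.cast_sum, Rat.cast_inv, Rat.cast_natCast] at this
      exact this
    have hlog : Real.log n ≤ (n : ℝ) ^ (σ / 2) / (σ / 2) :=
      Real.log_le_rpow_div (by linarith) (by linarith)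
    have hpow1 : (1 : ℝ) ≤ (n : ℝ) ^ (σ / 2) := Real.one_le_rpow hn1 hr
    calc ∑ m ∈ Icc 1 n, |cfun f m| ≤ ∑ m ∈ Icc 1 n, ((totDeg f : ℝ) + k) / (m : ℝ) :=
          sum_le_sum fun m _ => abs_cfun_le hf m
      _ = (totDeg f + k) * ∑ i ∈ Icc 1 n, (i : ℝ)⁻¹ := by
          rw [mul_sum]; exact sum_congr rfl fun m _ => by rw [div_eq_mul_inv]
      _ ≤ (totDeg f + k) * (1 + Real.log n) := mul_le_mul_of_nonneg_left hharm hDk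
      _ ≤ (totDeg f + k) * ((n : ℝ) ^ (σ / 2) + (n : ℝ) ^ (σ / 2) / (σ / 2)) := by gcongr
      _ = (totDeg f + k) * (1 + 2 / σ) * (n : ℝ) ^ (σ / 2) := by field_simp
  have hC := LSeries_eq_mul_integral' g hr (s := (σ : ℂ)) (by simpa using (by linarith : σ / 2 < σ)) hO
  have hSumm : LSeriesSummable g σ :=
    LSeriesSummable_of_sum_norm_bigO hO hr (by simpa using (by linarith : σ / 2 < σ))
  have hterm : ∀ n : ℕ, LSeries.term g σ n = ((cfun f n * (n : ℝ) ^ (-σ) : ℝ) : ℂ) := by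
    intro n
    rcases Nat.eq_zero_or_pos n with rfl | hn
    · simp [LSeries.term, cfun, Nat.not_prime_zero]
    · rw [LSeries.term_of_ne_zero hn.ne', hg]
      have hn0 : (0 : ℝ) ≤ n := Nat.cast_nonneg n
      rw [show ((n : ℕ) : ℂ) = (((n : ℕ) : ℝ) : ℂ) by norm_cast, ← Complex.ofReal_cpow hn0,
        Real.rpow_neg hn0]
      push_cast
      rw [div_eq_mul_inv]
  have hLHS : LSeries g σ = ((∑' n : ℕ, cfun f n * (n : ℝ) ^ (-σ) : ℝ) : ℂ) := by
    rw [LSeries, Complex.ofReal_tsum]; exact tsum_congr hterm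
  have hsumR : Summable fun n : ℕ => cfun f n * (n : ℝ) ^ (-σ) := by
    have : Summable fun n : ℕ => ((cfun f n * (n : ℝ) ^ (-σ) : ℝ) : ℂ) := by
      have h := hSumm
      rw [LSeriesSummable] at h
      exact h.congr hterm
    exact (Complex.summable_ofReal).mp this
  have hRHS : (σ : ℂ) * ∫ t in Set.Ioi (1 : ℝ), (∑ m ∈ Icc 1 ⌊t⌋₊, g m) * (t : ℂ) ^ (-((σ : ℂ) + 1)) =
      ((σ * ∫ x in Set.Ioi (1 : ℝ), csum f x * x ^ (-(σ + 1)) : ℝ) : ℂ) := by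
    have hint : ∫ t in Set.Ioi (1 : ℝ), (∑ m ∈ Icc 1 ⌊t⌋₊, g m) * (t : ℂ) ^ (-((σ : ℂ) + 1)) =
        ∫ t in Set.Ioi (1 : ℝ), ((csum f t * t ^ (-(σ + 1)) : ℝ) : ℂ) := by
      refine MeasureTheory.setIntegral_congr_fun measurableSet_Ioi fun t ht => ?_
      have ht0 : (0 : ℝ) ≤ t := by linarith [ht.out]
      rw [hg, ← Complex.ofReal_sum,
        show (-((σ : ℂ) + 1)) = ((-(σ + 1) : ℝ) : ℂ) by push_cast; ring, ← Complex.ofReal_cpow ht0]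
      simp only [csum]
      push_cast; ring
    rw [hint, integral_complex_ofReal]; push_cast; ring
  rw [hLHS, hRHS, Complex.ofReal_inj] at hC
  rw [← hC]
  exact hsumR.hasSum

/-- Helper `summable_cfun_rpow` (see the module docstring). [folklore] -/
private theorem summable_cfun_rpow (hf : IsBatemanHornSystem f) {σ : ℝ} (hσ : 0 < σ) :
    Summable fun n : ℕ => cfun f n * (n : ℝ) ^ (-σ) :=
  (hasSum_cfun_rpow hf hσ).summable

/-- **`H(δ) → L_c` as `δ → 0⁺`.** [cite: HardyWright2008, §22.8 (proof of Theorem 428)] -/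
private theorem tendsto_tsum_cfun_rpow (hf : IsBatemanHornSystem f) {Lc : ℝ}
    (hLc : Tendsto (csum f) atTop (𝓝 Lc)) :
    Tendsto (fun δ : ℝ => ∑' n : ℕ, cfun f n * (n : ℝ) ^ (-δ)) (𝓝[>] 0) (𝓝 Lc) := by
  have hint : ∀ σ : ℝ, 0 < σ →
      IntegrableOn (fun x => csum f x * x ^ (-(σ + 1))) (Set.Ioi 1) := fun σ hσ =>
    Literature.NumberTheory.LFunctions.Nicolas.integrableOn_rpow_of_le_log (measurable_csum f)
      (C := totDeg f + k) (fun x hx => abs_csum_le hf hx.le) hσ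
  have h := Literature.NumberTheory.LFunctions.Mertens.tendsto_mul_integral_rpow_of_tendsto hint hLc
  refine h.congr' ?_
  filter_upwards [self_mem_nhdsWithin] with δ hδ
  exact ((hasSum_cfun_rpow hf hδ).tsum_eq).symm

/-! ### The value at `δ = 0`: `∑_{p ≤ N} u(p, 0) = −log ∏_{p ≤ N} (1 − 1/p)^{-k}(1 − ω(p)/p)` -/

/-- Helper `sum_ufun_zero_eq` (see the module docstring). [folklore] -/
private theorem sum_ufun_zero_eq (hf : IsBatemanHornSystem f) (N : ℕ) :
    ∑ p ∈ Nat.primesLE N, ufun f p 0 = -Real.log (batemanHornPartial f N) := by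
  unfold batemanHornPartial
  rw [Fintype.card_fin, Real.log_prod]
  · rw [← sum_neg_distrib]
    refine sum_congr rfl fun p hp => ?_
    have hpp := Nat.prime_of_mem_primesLE hp
    have hp0 : (0 : ℝ) < p := by exact_mod_cast hpp.pos
    have hp1 : (1 : ℝ) < p := by exact_mod_cast hpp.one_lt
    have hA : 0 < 1 - 1 / (p : ℝ) := by
      have : 1 / (p : ℝ) < 1 := by rw [div_lt_one hp0]; exact hp1
      linarith
    have hB : 0 < 1 - (polyRootCountMod f p : ℝ) / p := by
      have := dens_lt_one hf hpp; rw [dens] at this; linarith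
    rw [ufun, if_pos hpp, neg_zero, Real.rpow_zero, mul_one, add_zero, Real.rpow_neg_one,
      Real.log_mul (pow_ne_zero _ (inv_ne_zero hA.ne')) hB.ne', Real.log_pow, Real.log_inv, dens,
      ← one_div]
    ring
  · intro p hp
    have hpp := Nat.prime_of_mem_primesLE hp
    have hp0 : (0 : ℝ) < p := by exact_mod_cast hpp.pos
    have hp1 : (1 : ℝ) < p := by exact_mod_cast hpp.one_lt
    have hA : 0 < 1 - 1 / (p : ℝ) := by
      have : 1 / (p : ℝ) < 1 := by rw [div_lt_one hp0]; exact hp1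
      linarith
    have hB : 0 < 1 - (polyRootCountMod f p : ℝ) / p := by
      have := dens_lt_one hf hpp; rw [dens] at this; linarith
    exact (mul_pos (pow_pos (inv_pos.mpr hA) _) hB).ne'

/-- `∑_{p ≤ N} u(p, 0) → −log C(f)`. [folklore] -/
private theorem tendsto_sum_ufun_zero (hf : IsBatemanHornSystem f) :
    Tendsto (fun N : ℕ => ∑ p ∈ Nat.primesLE N, ufun f p 0) atTop
      (𝓝 (-Real.log (batemanHornConst f))) := by
  have hbh := IsBatemanHornSystem.hasBatemanHornConst_holds hf
  have h := (hbh.1.log hbh.2.ne').neg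
  refine h.congr fun N => ?_
  exact (sum_ufun_zero_eq hf N).symm

/-- `u(n, 0) = c(n) + v(n, 0)`. [folklore] -/
private theorem ufun_zero_eq (n : ℕ) : ufun f n 0 = cfun f n + vfun f n 0 := by
  rw [vfun, neg_zero, Real.rpow_zero, mul_one]; ring

/-- **Identification of the constant:** `L_c + V(0) = −log C(f)`. [folklore] -/
private theorem Lc_add_tsum_vfun_zero (hf : IsBatemanHornSystem f) {Lc : ℝ}
    (hLc : Tendsto (fun N : ℕ => ∑ p ∈ Nat.primesLE N, cfun f p) atTop (𝓝 Lc)) :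
    Lc + ∑' n, vfun f n 0 = -Real.log (batemanHornConst f) := by
  have hv : Tendsto (fun N : ℕ => ∑ p ∈ Nat.primesLE N, vfun f p 0) atTop
      (𝓝 (∑' n, vfun f n 0)) := by
    have h1 := (summable_vfun hf le_rfl).hasSum.tendsto_sum_nat
    have h2 := h1.comp (tendsto_add_atTop_nat 1)
    refine h2.congr fun N => ?_
    simp only [Function.comp]
    exact sum_range_succ_eq_sum_primesLE (fun n hn => vfun_of_not_prime hn 0) N
  have hsum := hLc.add hv
  have heq : (fun N : ℕ => ∑ p ∈ Nat.primesLE N, cfun f p + ∑ p ∈ Nat.primesLE N, vfun f p 0) =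
      fun N => ∑ p ∈ Nat.primesLE N, ufun f p 0 := by
    funext N
    rw [← sum_add_distrib]
    exact sum_congr rfl fun p _ => (ufun_zero_eq p).symm
  rw [heq] at hsum
  exact tendsto_nhds_unique hsum (tendsto_sum_ufun_zero hf)

/-- **`S(δ) = ∑_n u(n, δ) → −log C(f)` as `δ → 0⁺`.** [folklore] -/
private theorem tendsto_tsum_ufun (hf : IsBatemanHornSystem f) :
    Tendsto (fun δ : ℝ => ∑' n : ℕ, ufun f n δ) (𝓝[>] 0)
      (𝓝 (-Real.log (batemanHornConst f))) := by
  obtain ⟨Lc, hLcN, hLcR⟩ := exists_tendsto_csum hf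
  have hH := tendsto_tsum_cfun_rpow hf hLcR
  have hV := tendsto_tsum_vfun hf
  have hsum := hH.add hV
  rw [Lc_add_tsum_vfun_zero hf hLcN] at hsum
  refine hsum.congr' ?_
  filter_upwards [self_mem_nhdsWithin] with δ hδ
  rw [← (summable_cfun_rpow hf hδ).tsum_add (summable_vfun hf (le_of_lt hδ))]
  refine tsum_congr fun n => ?_
  rw [vfun]; ring

/-- Helper `summable_ufun` (see the module docstring). [folklore] -/
private theorem summable_ufun (hf : IsBatemanHornSystem f) {δ : ℝ} (hδ : 0 < δ) :
    Summable fun n : ℕ => ufun f n δ := by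
  have h := (summable_cfun_rpow hf hδ).add (summable_vfun hf hδ.le)
  refine h.congr fun n => ?_
  rw [vfun]; ring

/-! ### Euler products: `∑ f̃(n) n^{-δ} = e^{S(δ)} ζ(1+δ)^k`-style factorisation and the limit -/

/-- `dens f n ≤ 1` for every `n` (`ω_f(n) ≤ n`). [folklore] -/
private theorem dens_le_one (f : Fin k → ℤ[X]) (n : ℕ) : dens f n ≤ 1 := by
  rw [dens]
  rcases Nat.eq_zero_or_pos n with rfl | hn
  · simp
  · rw [div_le_one (by exact_mod_cast hn)]
    exact_mod_cast polyRootCountMod_le f n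

/-- The twisted minorant `b_δ = cm (p ↦ dens(p) p^{-δ})`, a completely multiplicative function with
`0 ≤ b_δ(p) < 1`. [folklore] -/
private noncomputable def bHom (f : Fin k → ℤ[X]) (δ : ℝ) : ℕ →*₀ ℝ :=
  cmHom fun p => dens f p * (p : ℝ) ^ (-δ)

/-- Helper `bHom_apply` (see the module docstring). [folklore] -/
private theorem bHom_apply (f : Fin k → ℤ[X]) (δ : ℝ) (n : ℕ) :
    bHom f δ n = cm (dens f) n * (n : ℝ) ^ (-δ) := by
  rw [bHom, cmHom_apply, cm_mul_rpow]

/-- Helper `bHom_prime` (see the module docstring). [folklore] -/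
private theorem bHom_prime (f : Fin k → ℤ[X]) (δ : ℝ) {p : ℕ} (hp : p.Prime) :
    bHom f δ p = dens f p * (p : ℝ) ^ (-δ) := by
  rw [bHom, cmHom_apply, cm_prime _ hp]

/-- Helper `bHom_nonneg` (see the module docstring). [folklore] -/
private theorem bHom_nonneg (f : Fin k → ℤ[X]) (δ : ℝ) (n : ℕ) : 0 ≤ bHom f δ n := by
  rw [bHom, cmHom_apply]
  exact cm_nonneg (fun p => mul_nonneg (dens_nonneg f p) (Real.rpow_nonneg (Nat.cast_nonneg p) _)) n

/-- Helper `bHom_le_dens` (see the module docstring). [folklore] -/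
private theorem bHom_le_dens (f : Fin k → ℤ[X]) {δ : ℝ} (hδ : 0 ≤ δ) {p : ℕ} (hp : p.Prime) :
    bHom f δ p ≤ dens f p := by
  rw [bHom_prime f δ hp]
  have hp1 : (1 : ℝ) ≤ p := by exact_mod_cast hp.one_lt.le
  have hpδ : (p : ℝ) ^ (-δ) ≤ 1 := Real.rpow_le_one_of_one_le_of_nonpos hp1 (by linarith)
  calc dens f p * (p : ℝ) ^ (-δ) ≤ dens f p * 1 :=
        mul_le_mul_of_nonneg_left hpδ (dens_nonneg f p)
    _ = dens f p := mul_one _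

/-- Helper `bHom_prime_lt_one` (see the module docstring). [folklore] -/
private theorem bHom_prime_lt_one (hf : IsBatemanHornSystem f) {δ : ℝ} (hδ : 0 ≤ δ) {p : ℕ}
    (hp : p.Prime) : bHom f δ p < 1 :=
  (bHom_le_dens f hδ hp).trans_lt (dens_lt_one hf hp)

/-- `−log(1 − b_δ(p)) ≤ 2 D p^{-1-δ} + [p ≤ 2D]·(−log(1 − dens p))` at primes. [folklore] -/
private theorem neg_log_one_sub_bHom_le (hf : IsBatemanHornSystem f) {δ : ℝ} (hδ : 0 ≤ δ) {p : ℕ}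
    (hp : p.Prime) :
    -Real.log (1 - bHom f δ p) ≤
      2 * totDeg f * (p : ℝ) ^ (-(1 + δ)) +
        (if p ≤ 2 * totDeg f then -Real.log (1 - dens f p) else 0) := by
  have hp0 : (0 : ℝ) < p := by exact_mod_cast hp.pos
  have hpδ0 : 0 ≤ (p : ℝ) ^ (-δ) := Real.rpow_nonneg hp0.le _
  have hb := bHom_prime f δ hp
  have hble : bHom f δ p ≤ dens f p := bHom_le_dens f hδ hp
  have hb0 : 0 ≤ bHom f δ p := bHom_nonneg f δ p
  have hd1 := dens_lt_one hf hp
  have hfirst : 0 ≤ 2 * totDeg f * (p : ℝ) ^ (-(1 + δ)) := by positivity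
  by_cases hpD : p ≤ 2 * totDeg f
  · rw [if_pos hpD]
    have hmono : -Real.log (1 - bHom f δ p) ≤ -Real.log (1 - dens f p) := by
      have := Real.log_le_log (by linarith : 0 < 1 - dens f p)
        (by linarith : 1 - dens f p ≤ 1 - bHom f δ p)
      linarith
    linarith
  · rw [if_neg hpD, add_zero]
    push Not at hpD
    have hbh : bHom f δ p ≤ 1 / 2 := hble.trans (dens_le_half hf hp hpD)
    obtain ⟨-, h2⟩ := neg_log_one_sub_sub_bounds hb0 hbh
    have hb2 : -Real.log (1 - bHom f δ p) ≤ 2 * bHom f δ p := by nlinarith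
    have hbD : bHom f δ p ≤ totDeg f / p * (p : ℝ) ^ (-δ) := by
      rw [hb]; exact mul_le_mul_of_nonneg_right (dens_le_div hf hp) hpδ0
    have hsplit : (p : ℝ) ^ (-(1 + δ)) = (p : ℝ)⁻¹ * (p : ℝ) ^ (-δ) := by
      rw [neg_add, Real.rpow_add hp0, Real.rpow_neg_one]
    rw [hsplit]
    calc -Real.log (1 - bHom f δ p) ≤ 2 * bHom f δ p := hb2
      _ ≤ 2 * (totDeg f / p * (p : ℝ) ^ (-δ)) := by linarith
      _ = 2 * totDeg f * ((p : ℝ)⁻¹ * (p : ℝ) ^ (-δ)) := by ring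

/-- **`‖b_δ‖` is summable for `δ > 0`**: the partial sums are bounded by the finite Euler products
`∏_{p < N} (1 − b_δ(p))⁻¹ ≤ exp(∑_p −log(1 − b_δ(p))) < ∞`. [folklore] -/
private theorem summable_norm_bHom (hf : IsBatemanHornSystem f) {δ : ℝ} (hδ : 0 < δ) :
    Summable fun n : ℕ => ‖bHom f δ n‖ := by
  -- the dominating series for `-log(1 - b_δ p)`
  set w : ℕ → ℝ := fun n => if n.Prime then -Real.log (1 - bHom f δ n) else 0 with hw
  set wb : ℕ → ℝ := fun n => 2 * totDeg f * (n : ℝ) ^ (-(1 + δ)) +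
    (if n ≤ 2 * totDeg f then -Real.log (1 - dens f n) else 0) with hwb
  have hterm2 : ∀ n, 0 ≤ (if n ≤ 2 * totDeg f then -Real.log (1 - dens f n) else 0) := by
    intro n
    split_ifs
    · have := Real.log_nonpos (by linarith [dens_le_one f n] : 0 ≤ 1 - dens f n)
        (by linarith [dens_nonneg f n] : 1 - dens f n ≤ 1)
      linarith
    · exact le_rfl
  have hw0 : ∀ n, 0 ≤ w n := by
    intro n; rw [hw]; simp only
    split_ifs with hn
    · have h1 := bHom_prime_lt_one hf hδ.le hn
      have := Real.log_le_sub_one_of_pos (by linarith : 0 < 1 - bHom f δ n)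
      linarith [bHom_nonneg f δ n]
    · exact le_rfl
  have hwb_sum : Summable wb := by
    refine Summable.add ?_ ?_
    · exact (Real.summable_nat_rpow.mpr (by linarith : -(1 + δ) < -1)).mul_left _
    · refine summable_of_ne_finset_zero (s := Finset.range (2 * totDeg f + 1)) fun n hn => ?_
      rw [Finset.mem_range] at hn
      exact if_neg (by omega)
  have hw_le : ∀ n, w n ≤ wb n := by
    intro n; rw [hw, hwb]; simp only
    by_cases hn : n.Prime
    · rw [if_pos hn]; exact neg_log_one_sub_bHom_le hf hδ.le hn
    · rw [if_neg hn]
      have h1 : 0 ≤ 2 * totDeg f * (n : ℝ) ^ (-(1 + δ)) := by positivity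
      linarith [hterm2 n]
  have hw_sum : Summable w :=
    hwb_sum.of_nonneg_of_le hw0 hw_le
  set M : ℝ := Real.exp (∑' n, w n) with hM
  -- the partial sums of `b_δ` are bounded by `M`
  have hb1 : ∀ {p : ℕ}, p.Prime → ‖(bHom f δ : ℕ →* ℝ) p‖ < 1 := by
    intro p hp
    change ‖bHom f δ p‖ < 1
    rw [Real.norm_of_nonneg (bHom_nonneg f δ p)]
    exact bHom_prime_lt_one hf hδ.le hp
  have hpartial : ∀ N : ℕ, ∑ n ∈ Finset.range N, ‖bHom f δ n‖ ≤ M := by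
    intro N
    have hE := (EulerProduct.summable_and_hasSum_smoothNumbers_prod_primesBelow_geometric hb1 N).2
    -- `∑_{1 ≤ n < N} b n ≤ ∏_{p < N} (1 - b p)⁻¹`
    have hsub : ∑ n ∈ Finset.Ico 1 N, bHom f δ n ≤
        ∏ p ∈ N.primesBelow, (1 - (bHom f δ : ℕ →* ℝ) p)⁻¹ := by
      have heq : ∑ n ∈ Finset.Ico 1 N, bHom f δ n =
          ∑ x ∈ (Finset.Ico 1 N).subtype (· ∈ N.smoothNumbers), (bHom f δ : ℕ →* ℝ) x := by
        rw [Finset.sum_subtype_eq_sum_filter, Finset.filter_true_of_mem]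
        · rfl
        · intro n hn
          rw [Finset.mem_Ico] at hn
          exact Nat.mem_smoothNumbers_of_lt hn.1 hn.2
      rw [heq]
      refine sum_le_hasSum _ (fun x _ => ?_) hE
      exact bHom_nonneg f δ x
    -- the Euler product is at most `M`
    have hprod : ∏ p ∈ N.primesBelow, (1 - (bHom f δ : ℕ →* ℝ) p)⁻¹ ≤ M := by
      have hpos : ∀ p ∈ N.primesBelow, 0 < 1 - (bHom f δ : ℕ →* ℝ) p := by
        intro p hp
        have hpp := (Nat.mem_primesBelow.mp hp).2
        have := bHom_prime_lt_one hf hδ.le hpp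
        change 0 < 1 - bHom f δ p
        linarith
      rw [← Real.exp_log (prod_pos fun p hp => inv_pos.mpr (hpos p hp)), hM, Real.exp_le_exp,
        Real.log_prod (fun p hp => (inv_pos.mpr (hpos p hp)).ne')]
      calc ∑ p ∈ N.primesBelow, Real.log (1 - (bHom f δ : ℕ →* ℝ) p)⁻¹
          = ∑ p ∈ N.primesBelow, w p := by
            refine sum_congr rfl fun p hp => ?_
            rw [hw]; simp only
            rw [if_pos (Nat.mem_primesBelow.mp hp).2, Real.log_inv]
            rfl
        _ ≤ ∑' n, w n := by
            refine hw_sum.sum_le_tsum _ fun n _ => hw0 n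
    calc ∑ n ∈ Finset.range N, ‖bHom f δ n‖ = ∑ n ∈ Finset.range N, bHom f δ n :=
          sum_congr rfl fun n _ => Real.norm_of_nonneg (bHom_nonneg f δ n)
      _ = ∑ n ∈ Finset.Ico 1 N, bHom f δ n := by
          rcases Nat.eq_zero_or_pos N with rfl | hN
          · simp
          · rw [Finset.range_eq_Ico, Finset.sum_eq_sum_Ico_succ_bot hN, map_zero, zero_add]
      _ ≤ _ := hsub
      _ ≤ M := hprod
  exact summable_of_sum_range_le (fun n => norm_nonneg _) hpartial

/-- The real Euler product for `ζ(1 + δ)`: `n ↦ n^{-(1+δ)}` as a monoid-with-zero hom. [folklore] -/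
private noncomputable def zHom (s : ℝ) (hs : 0 < s) : ℕ →*₀ ℝ where
  toFun n := (n : ℝ) ^ (-s)
  map_zero' := by
    simp only [Nat.cast_zero]
    exact Real.zero_rpow (neg_ne_zero.mpr hs.ne')
  map_one' := by simp
  map_mul' m n := by
    simp only [Nat.cast_mul]
    exact Real.mul_rpow (Nat.cast_nonneg m) (Nat.cast_nonneg n)

/-- Helper `zHom_apply` (see the module docstring). [folklore] -/
private theorem zHom_apply (s : ℝ) (hs : 0 < s) (n : ℕ) : zHom s hs n = (n : ℝ) ^ (-s) := rfl

set_option maxHeartbeats 400000 in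
/-- `∏_p (1 − p^{-(1+δ)})⁻¹ = ∑_n n^{-(1+δ)}` (`δ > 0`). [folklore] -/
private theorem hasProd_zeta {δ : ℝ} (hδ : 0 < δ) :
    HasProd (fun p : Nat.Primes => (1 - ((p : ℕ) : ℝ) ^ (-(1 + δ)))⁻¹)
      (∑' n : ℕ, (n : ℝ) ^ (-(1 + δ))) := by
  have hs : 0 < 1 + δ := by linarith
  have hsum : Summable fun n : ℕ => ‖zHom (1 + δ) hs n‖ := by
    have h := Real.summable_nat_rpow.mpr (by linarith : -(1 + δ) < -1)
    refine h.congr fun n => ?_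
    rw [zHom_apply, Real.norm_of_nonneg (Real.rpow_nonneg (Nat.cast_nonneg n) _)]
  exact EulerProduct.eulerProduct_completely_multiplicative_hasProd hsum

/-- `δ ζ(1+δ) → 1` (`δ → 0⁺`), real form (Mathlib `tendsto_sub_mul_tsum_nat_rpow`). [folklore] -/
private theorem tendsto_delta_mul_zeta :
    Tendsto (fun δ : ℝ => δ * ∑' n : ℕ, (n : ℝ) ^ (-(1 + δ))) (𝓝[>] 0) (𝓝 1) := by
  have h := tendsto_sub_mul_tsum_nat_rpow
  have hmap : Tendsto (fun δ : ℝ => 1 + δ) (𝓝[>] 0) (𝓝[>] 1) := by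
    refine tendsto_nhdsWithin_of_tendsto_nhds_of_eventually_within _ ?_ ?_
    · have : Tendsto (fun δ : ℝ => 1 + δ) (𝓝 0) (𝓝 (1 + 0)) :=
        ((continuous_const.add continuous_id).tendsto 0)
      rw [add_zero] at this
      exact this.mono_left nhdsWithin_le_nhds
    · filter_upwards [self_mem_nhdsWithin] with δ hδ
      simp only [Set.mem_Ioi] at hδ ⊢
      linarith
  refine (h.comp hmap).congr fun δ => ?_
  simp only [Function.comp_apply, add_sub_cancel_left]
  congr 1
  refine tsum_congr fun n => ?_
  rw [one_div, Real.rpow_neg (Nat.cast_nonneg n)]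

/-- At a prime `p`: `(1 − b_δ(p))⁻¹ = e^{u(p,δ)} · ((1 − p^{-(1+δ)})⁻¹)^k`. [folklore] -/
private theorem euler_factor_eq (hf : IsBatemanHornSystem f) {δ : ℝ} (hδ : 0 < δ) (p : Nat.Primes) :
    (1 - bHom f δ p)⁻¹ =
      Real.exp (ufun f p δ) * ((1 - ((p : ℕ) : ℝ) ^ (-(1 + δ)))⁻¹) ^ k := by
  have hp : (p : ℕ).Prime := p.prop
  have hp0 : (0 : ℝ) < (p : ℕ) := by exact_mod_cast hp.pos
  have hp2 : (2 : ℝ) ≤ (p : ℕ) := by exact_mod_cast hp.two_le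
  have ht₁ : dens f p * ((p : ℕ) : ℝ) ^ (-δ) < 1 := by
    rw [← bHom_prime f δ hp]; exact bHom_prime_lt_one hf hδ.le hp
  have hpδ : ((p : ℕ) : ℝ) ^ (-δ) ≤ 1 :=
    Real.rpow_le_one_of_one_le_of_nonpos (by linarith) (by linarith)
  have ht₂ : ((p : ℕ) : ℝ) ^ (-(1 + δ)) < 1 := by
    rw [neg_add, Real.rpow_add hp0, Real.rpow_neg_one]
    have h1 : ((p : ℕ) : ℝ)⁻¹ ≤ 2⁻¹ := by
      rw [inv_le_inv₀ hp0 (by norm_num)]; exact hp2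
    have h2 : ((p : ℕ) : ℝ)⁻¹ * ((p : ℕ) : ℝ) ^ (-δ) ≤ ((p : ℕ) : ℝ)⁻¹ :=
      mul_le_of_le_one_right (inv_nonneg.mpr hp0.le) hpδ
    linarith [(by norm_num : (2 : ℝ)⁻¹ < 1)]
  rw [bHom_prime f δ hp, ufun, if_pos hp, Real.exp_add, Real.exp_neg,
    Real.exp_log (by linarith), Real.exp_nat_mul, Real.exp_log (by linarith), inv_pow, mul_assoc,
    mul_inv_cancel₀ (pow_ne_zero _ (by linarith)), mul_one]

/-- **`∑_n b_δ(n) = e^{S(δ)} · (∑_n n^{-(1+δ)})^k`** (`δ > 0`): the Euler product of the twisted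
minorant split into the normalising product and `ζ(1+δ)^k`. [folklore] -/
private theorem tsum_bHom_eq (hf : IsBatemanHornSystem f) {δ : ℝ} (hδ : 0 < δ) :
    ∑' n, bHom f δ n =
      Real.exp (∑' n, ufun f n δ) * (∑' n : ℕ, (n : ℝ) ^ (-(1 + δ))) ^ k := by
  have h1 : HasProd (fun p : Nat.Primes => (1 - bHom f δ p)⁻¹) (∑' n, bHom f δ n) :=
    EulerProduct.eulerProduct_completely_multiplicative_hasProd (summable_norm_bHom hf hδ)
  have hind : Set.indicator {p : ℕ | p.Prime} (fun n => ufun f n δ) = fun n => ufun f n δ := by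
    funext n
    by_cases hn : n.Prime
    · exact Set.indicator_of_mem (show n ∈ {p : ℕ | p.Prime} from hn) _
    · rw [Set.indicator_of_notMem (show n ∉ {p : ℕ | p.Prime} from hn), ufun_of_not_prime hn]
  have h2 : HasSum (Set.indicator {p : ℕ | p.Prime} (fun n => ufun f n δ)) (∑' n, ufun f n δ) := by
    rw [hind]; exact (summable_ufun hf hδ).hasSum
  have hS : HasSum (fun p : Nat.Primes => ufun f p δ) (∑' n, ufun f n δ) :=
    (hasSum_subtype_iff_indicator (s := {p : ℕ | p.Prime}) (f := fun n => ufun f n δ)).mpr h2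
  have hexp : HasProd (fun p : Nat.Primes => Real.exp (ufun f p δ))
      (Real.exp (∑' n, ufun f n δ)) := by
    have := hS.rexp
    simpa [Function.comp_def] using this
  have hZ := (hasProd_zeta hδ).pow k
  have h3 := hexp.mul hZ
  have hfun : (fun p : Nat.Primes => (1 - bHom f δ p)⁻¹) =
      fun p : Nat.Primes => Real.exp (ufun f p δ) * ((1 - ((p : ℕ) : ℝ) ^ (-(1 + δ)))⁻¹) ^ k :=
    funext (euler_factor_eq hf hδ)
  rw [hfun] at h1
  exact h1.unique h3

/-- **`δ^k ∑_n b_δ(n) → 1/C(f)`** as `δ → 0⁺`. [folklore] -/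
private theorem tendsto_pow_mul_tsum_bHom (hf : IsBatemanHornSystem f) :
    Tendsto (fun δ : ℝ => δ ^ k * ∑' n, bHom f δ n) (𝓝[>] 0) (𝓝 (batemanHornConst f)⁻¹) := by
  have hbh := IsBatemanHornSystem.hasBatemanHornConst_holds hf
  have hC : 0 < batemanHornConst f := hbh.2
  have hexpS : Tendsto (fun δ : ℝ => Real.exp (∑' n, ufun f n δ)) (𝓝[>] 0)
      (𝓝 (batemanHornConst f)⁻¹) := by
    have h := (tendsto_tsum_ufun hf).rexp
    rw [Real.exp_neg, Real.exp_log hC] at h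
    simpa [Function.comp_def] using h
  have hZ := tendsto_delta_mul_zeta.pow k
  have h := hexpS.mul hZ
  rw [one_pow, mul_one] at h
  refine h.congr' ?_
  filter_upwards [self_mem_nhdsWithin] with δ hδ
  rw [tsum_bHom_eq hf hδ, mul_pow]
  ring

/-- The same limit in the variables of Karamata's theorem: `δ^k ∑_n f̃(n) e^{−δ log n} → 1/C(f)`.
[folklore] -/
private theorem tendsto_rpow_mul_tsum_cm_exp (hf : IsBatemanHornSystem f) :
    Tendsto (fun δ : ℝ => δ ^ (k : ℝ) * ∑' n : ℕ, cm (dens f) n * Real.exp (-(δ * Real.log n)))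
      (𝓝[>] 0) (𝓝 (batemanHornConst f)⁻¹) := by
  refine (tendsto_pow_mul_tsum_bHom hf).congr' ?_
  filter_upwards [self_mem_nhdsWithin] with δ hδ
  rw [Real.rpow_natCast]
  congr 1
  refine tsum_congr fun n => ?_
  rw [bHom_apply]
  rcases Nat.eq_zero_or_pos n with rfl | hn
  · simp [cm_zero]
  · congr 1
    rw [Real.rpow_def_of_pos (by exact_mod_cast hn : (0 : ℝ) < n)]
    congr 1
    ring

/-! ### Karamata's Tauberian theorem applied to `U = ∑_n f̃(n) δ_{log n}` -/

/-- The minorant's weights `q_n = f̃(n) = cm (dens f) n ≥ 0`. [folklore] -/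
private theorem cm_dens_nonneg (f : Fin k → ℤ[X]) (n : ℕ) : 0 ≤ cm (dens f) n :=
  cm_nonneg (dens_nonneg f) n

/-- The atomic measure `U = ∑_n f̃(n) δ_{log n}`. [folklore] -/
private noncomputable def muK (f : Fin k → ℤ[X]) : Measure ℝ :=
  Measure.sum (fun n : ℕ => ENNReal.ofReal (cm (dens f) n) • Measure.dirac (Real.log n))

/-- Helper `muK_apply` (see the module docstring). [folklore] -/
private theorem muK_apply (f : Fin k → ℤ[X]) {s : Set ℝ} (hs : MeasurableSet s) :
    muK f s = ∑' n : ℕ, ENNReal.ofReal (cm (dens f) n) * s.indicator 1 (Real.log n) := by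
  rw [muK, Measure.sum_apply _ hs]
  refine tsum_congr fun n => ?_
  rw [Measure.smul_apply, smul_eq_mul, Measure.dirac_apply' _ hs]

/-- Helper `muK_Iio` (see the module docstring). [folklore] -/
private theorem muK_Iio (f : Fin k → ℤ[X]) : muK f (Set.Iio 0) = 0 := by
  rw [muK_apply f measurableSet_Iio, ENNReal.tsum_eq_zero]
  intro n
  rw [Set.indicator_of_notMem, mul_zero]
  simp only [Set.mem_Iio, not_lt]
  exact Real.log_natCast_nonneg n

/-- `log n ≤ T ↔ n ≤ ⌊e^T⌋` for `T ≥ 0`. [folklore] -/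
private theorem log_le_iff_mem_range {T : ℝ} (hT : 0 ≤ T) (n : ℕ) :
    Real.log n ≤ T ↔ n ∈ Finset.range (⌊Real.exp T⌋₊ + 1) := by
  rw [Finset.mem_range, Nat.lt_succ_iff, Nat.le_floor_iff (Real.exp_pos T).le]
  rcases Nat.eq_zero_or_pos n with rfl | hn
  · simp only [Nat.cast_zero, Real.log_zero]
    exact ⟨fun _ => (Real.exp_pos T).le, fun _ => hT⟩
  · exact Real.log_le_iff_le_exp (by exact_mod_cast hn)

/-- Helper `muK_Iic` (see the module docstring). [folklore] -/
private theorem muK_Iic (f : Fin k → ℤ[X]) {T : ℝ} (hT : 0 ≤ T) :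
    muK f (Set.Iic T) = ENNReal.ofReal (∑ n ∈ Finset.range (⌊Real.exp T⌋₊ + 1), cm (dens f) n) := by
  rw [muK_apply f measurableSet_Iic]
  have hterm : ∀ n : ℕ, ENNReal.ofReal (cm (dens f) n) * (Set.Iic T).indicator (1 : ℝ → ENNReal)
      (Real.log n) = if n ∈ Finset.range (⌊Real.exp T⌋₊ + 1) then ENNReal.ofReal (cm (dens f) n)
        else 0 := by
    intro n
    by_cases h : Real.log n ≤ T
    · rw [Set.indicator_of_mem (show Real.log n ∈ Set.Iic T from h), Pi.one_apply, mul_one,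
        if_pos ((log_le_iff_mem_range hT n).mp h)]
    · rw [Set.indicator_of_notMem (show Real.log n ∉ Set.Iic T from h), mul_zero,
        if_neg (fun h' => h ((log_le_iff_mem_range hT n).mpr h'))]
  simp_rw [hterm]
  rw [tsum_eq_sum (s := Finset.range (⌊Real.exp T⌋₊ + 1)) (fun n hn => if_neg hn),
    ENNReal.ofReal_sum_of_nonneg (fun n _ => cm_dens_nonneg f n)]
  exact Finset.sum_congr rfl fun n hn => if_pos hn

/-- Helper `muK_real_Iic` (see the module docstring). [folklore] -/
private theorem muK_real_Iic (f : Fin k → ℤ[X]) {T : ℝ} (hT : 0 ≤ T) :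
    (muK f).real (Set.Iic T) = ∑ n ∈ Finset.range (⌊Real.exp T⌋₊ + 1), cm (dens f) n := by
  rw [measureReal_def, muK_Iic f hT,
    ENNReal.toReal_ofReal (Finset.sum_nonneg fun n _ => cm_dens_nonneg f n)]

/-- Helper `integral_exp_muK` (see the module docstring). [folklore] -/
private theorem integral_exp_muK (f : Fin k → ℤ[X]) (t : ℝ) :
    ∫ x, Real.exp (-(t * x)) ∂(muK f) = ∑' n : ℕ, cm (dens f) n * Real.exp (-(t * Real.log n)) := by
  rw [muK, integral_sum_dirac (fun n => ENNReal.ofReal_ne_top)]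
  refine tsum_congr fun n => ?_
  rw [ENNReal.toReal_ofReal (cm_dens_nonneg f n), smul_eq_mul]

/-- Helper `integrable_exp_muK_iff` (see the module docstring). [folklore] -/
private theorem integrable_exp_muK_iff (f : Fin k → ℤ[X]) (t : ℝ) :
    Integrable (fun x => Real.exp (-(t * x))) (muK f) ↔
      Summable fun n : ℕ => cm (dens f) n * Real.exp (-(t * Real.log n)) := by
  rw [muK, integrable_sum_dirac_iff (fun n => ENNReal.ofReal_ne_top)]
  refine summable_congr fun n => ?_
  rw [ENNReal.toReal_ofReal (cm_dens_nonneg f n), Real.norm_eq_abs, abs_of_pos (Real.exp_pos _)]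

/-- Summability of the Dirichlet series of the minorant for `t > 0`. [folklore] -/
private theorem summable_cm_exp (hf : IsBatemanHornSystem f) {t : ℝ} (ht : 0 < t) :
    Summable fun n : ℕ => cm (dens f) n * Real.exp (-(t * Real.log n)) := by
  have h := (summable_norm_bHom hf ht).of_norm
  refine h.congr fun n => ?_
  rw [bHom_apply]
  rcases Nat.eq_zero_or_pos n with rfl | hn
  · simp [cm_zero]
  · congr 1
    rw [Real.rpow_def_of_pos (by exact_mod_cast hn : (0 : ℝ) < n)]
    congr 1
    ring

/-- **The mean value of the minorant (Karamata):**
`(∑_{n ≤ e^T} f̃(n)) / T^k → 1/(C(f) Γ(k+1))` as `T → ∞`. [folklore] -/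
private theorem tendsto_sum_cm_div_rpow (hf : IsBatemanHornSystem f) :
    Tendsto (fun T : ℝ => (∑ n ∈ Finset.range (⌊Real.exp T⌋₊ + 1), cm (dens f) n) / T ^ (k : ℝ))
      atTop (𝓝 ((batemanHornConst f)⁻¹ / Real.Gamma ((k : ℝ) + 1))) := by
  have hint : ∀ δ : ℝ, 0 < δ → Integrable (fun x => Real.exp (-(δ * x))) (muK f) := fun δ hδ =>
    (integrable_exp_muK_iff f δ).mpr (summable_cm_exp hf hδ)
  have hω : Tendsto (fun δ : ℝ => δ ^ (k : ℝ) * ∫ x, Real.exp (-(δ * x)) ∂(muK f)) (𝓝[>] 0)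
      (𝓝 (batemanHornConst f)⁻¹) := by
    simp_rw [integral_exp_muK]
    exact tendsto_rpow_mul_tsum_cm_exp hf
  have h := Literature.Analysis.Asymptotics.karamata_tauberian_measure_of_tendsto_rpow_mul
    (μ := muK f) (Nat.cast_nonneg k) (muK_Iio f) hint hω
  refine h.congr' ?_
  filter_upwards [eventually_ge_atTop 0] with T hT
  rw [muK_real_Iic f hT]

/-- **The mean value of the minorant in the variable `x`:**
`(∑_{n ≤ x} f̃(n)) / (log x)^k → 1/(k! C(f))` as `x → ∞`. [folklore] -/
private theorem tendsto_sum_cm_div_log_pow (hf : IsBatemanHornSystem f) :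
    Tendsto (fun x : ℝ => (∑ n ∈ Finset.range (⌊x⌋₊ + 1), cm (dens f) n) / Real.log x ^ k)
      atTop (𝓝 ((batemanHornConst f)⁻¹ / (k.factorial : ℝ))) := by
  have h := (tendsto_sum_cm_div_rpow hf).comp Real.tendsto_log_atTop
  rw [Real.Gamma_nat_eq_factorial] at h
  refine h.congr' ?_
  filter_upwards [eventually_gt_atTop 0] with x hx
  simp only [Function.comp_apply]
  rw [Real.exp_log hx, Real.rpow_natCast]

/-- **The mean value of the completely multiplicative minorant of Selberg's sum for a Bateman–Horn
system** (the `G(z)`-asymptotic of the source, Theorem 2 of §2.2.2, in the Bateman–Horn setting of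
§2.3.3 Theorem 4, `κ = k`): let `f̃` be the completely multiplicative function with
`f̃(p) = ω_f(p)/p` at the primes (spelled out: `f̃(n) = ∏_{p^m ∥ n} (ω_f(p)/p)^m`, `f̃(0) = 0`). Then
`(∑_{n ≤ x} f̃(n)) / (log x)^k → 1/(k! · C(f))` as `x → ∞`, where `C(f) = batemanHornConst f =
∏_p (1 − 1/p)^{-k}(1 − ω_f(p)/p)`. (Since Selberg's `G(z) ≥ ∑_{n < z} f̃(n)` — tree
`SelbergSieve.sum_le_selbergSum_of_multiplicative` — this is the lower bound
`G(z) ≥ (1 + o(1)) (log z)^κ/(Γ(κ+1) ∏_p (1 − 1/p)^{-κ}(1 − ρ(p)/p))` of the source's (2.3)–(2.4) for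
these sequences.) Proof: Karamata's Tauberian theorem for `∑ f̃(n) n^{-δ} =
e^{S(δ)} ζ(1+δ)^k`, `S(δ) → −log C(f)`.
[cite: Greaves2001, §2.2.2 Theorem 2 with (2.4), and §2.3.3 Theorem 4] -/
theorem tendsto_sum_rootMinorant_div_log_pow {f : Fin k → ℤ[X]} (hf : IsBatemanHornSystem f) :
    Tendsto (fun x : ℝ => (∑ n ∈ Finset.range (⌊x⌋₊ + 1),
        (if n = 0 then (0 : ℝ)
          else n.factorization.prod fun p m => ((polyRootCountMod f p : ℝ) / p) ^ m)) /
        Real.log x ^ k)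
      atTop (𝓝 ((batemanHornConst f)⁻¹ / (k.factorial : ℝ))) :=
  tendsto_sum_cm_div_log_pow hf

/-! ## Part B: Selberg's `Λ²` sieve on the values of the product polynomial

### The remainder terms `∑_{d ∣ P, d ≤ D} 3^{ν(d)} ρ_F(d) ≪ D (log D)^K` -/

section PartB

open scoped ArithmeticFunction.sigma ArithmeticFunction.omega

/-- `ρ_F(d) = ∏_{p ∣ d} ρ_F(p)` for square-free `d` (multiplicativity of `rootDensity`). [folklore] -/
private theorem rootCount_eq_prod_of_squarefree (F : ℤ[X]) {d : ℕ} (hd : Squarefree d) :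
    (polyRootCountMod ![F] d : ℝ) = ∏ p ∈ d.primeFactors, (polyRootCountMod ![F] p : ℝ) := by
  have hd0 : d ≠ 0 := hd.ne_zero
  have hmult := isMultiplicative_rootDensity F
  have hprod : (∏ p ∈ d.primeFactors, p) = d := Nat.prod_primeFactors_of_squarefree hd
  have h1 : rootDensity F d = ∏ p ∈ d.primeFactors, rootDensity F p := by
    conv_lhs => rw [← hprod]
    exact hmult.map_prod_of_subset_primeFactors d d.primeFactors Finset.Subset.rfl
  simp only [rootDensity_apply] at h1
  have hd' : (d : ℝ) ≠ 0 := by exact_mod_cast hd0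
  have h2 : (polyRootCountMod ![F] d : ℝ) = (d : ℝ) * ∏ p ∈ d.primeFactors,
      ((polyRootCountMod ![F] p : ℝ) / p) := by
    rw [← h1]; field_simp
  have hcast : (d : ℝ) = ∏ p ∈ d.primeFactors, (p : ℝ) := by rw [← Nat.cast_prod, hprod]
  calc (polyRootCountMod ![F] d : ℝ)
      = (d : ℝ) * ∏ p ∈ d.primeFactors, ((polyRootCountMod ![F] p : ℝ) / p) := h2
    _ = (∏ p ∈ d.primeFactors, (p : ℝ)) *
          ∏ p ∈ d.primeFactors, ((polyRootCountMod ![F] p : ℝ) / p) := by rw [← hcast]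
    _ = ∏ p ∈ d.primeFactors, ((p : ℝ) * ((polyRootCountMod ![F] p : ℝ) / p)) := by
          rw [← Finset.prod_mul_distrib]
    _ = ∏ p ∈ d.primeFactors, (polyRootCountMod ![F] p : ℝ) := by
          refine Finset.prod_congr rfl fun p hp => ?_
          have hp0 : (p : ℝ) ≠ 0 := by
            exact_mod_cast (Nat.prime_of_mem_primeFactors hp).ne_zero
          field_simp

/-- `#d.divisors = 2^{#primeFactors d}` and `ω(d) = #primeFactors d` for square-free `d`. [folklore] -/
private theorem sigma_zero_eq_two_pow_omega {d : ℕ} (hd : Squarefree d) :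
    (σ 0 d : ℝ) = 2 ^ ω d := by
  have h1 : σ 0 d = 2 ^ d.primeFactors.card := by
    rw [ArithmeticFunction.sigma_zero_apply, Nat.card_divisors hd.ne_zero, ← Finset.prod_const]
    refine Finset.prod_congr rfl fun p hp => ?_
    rw [Nat.factorization_eq_one_of_squarefree hd (Nat.prime_of_mem_primeFactors hp)
      (Nat.dvd_of_mem_primeFactors hp)]
  have h2 : ω d = d.primeFactors.card := by
    rw [ArithmeticFunction.cardDistinctFactors_apply, ← List.card_toFinset]
    rfl
  rw [h1, h2]
  push_cast
  ring

/-- For square-free `d`, `ρ_F(p) < p` at all primes: `3^{ω(d)} ρ_F(d) ≤ τ(d)^{deg F + 2}`. [folklore] -/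
private theorem three_pow_mul_rootCount_le (F : ℤ[X])
    (hρlt : ∀ p : ℕ, p.Prime → polyRootCountMod ![F] p < p) {d : ℕ} (hd : Squarefree d) :
    (3 : ℝ) ^ ω d * (polyRootCountMod ![F] d : ℝ) ≤ (σ 0 d : ℝ) ^ (F.natDegree + 2) := by
  rw [rootCount_eq_prod_of_squarefree F hd, sigma_zero_eq_two_pow_omega hd]
  have h1 : ∏ p ∈ d.primeFactors, (polyRootCountMod ![F] p : ℝ) ≤
      ∏ _p ∈ d.primeFactors, (F.natDegree : ℝ) := by
    refine Finset.prod_le_prod (fun _ _ => Nat.cast_nonneg _) fun p hp => ?_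
    have hpp := Nat.prime_of_mem_primeFactors hp
    exact_mod_cast PolyPrimeCountBrun.polyRootCountMod_single_le_natDegree_of_lt hpp (hρlt p hpp)
  have h2 : ω d = d.primeFactors.card := by
    rw [ArithmeticFunction.cardDistinctFactors_apply, ← List.card_toFinset]
    rfl
  rw [Finset.prod_const, ← h2] at h1
  have hg : (F.natDegree : ℝ) ≤ 2 ^ F.natDegree := by
    exact_mod_cast (Nat.lt_two_pow_self).le
  have h3 : (F.natDegree : ℝ) ^ ω d ≤ (2 ^ F.natDegree) ^ ω d :=
    pow_le_pow_left₀ (Nat.cast_nonneg _) hg _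
  have h4 : (3 : ℝ) ^ ω d ≤ (2 ^ 2) ^ ω d := pow_le_pow_left₀ (by norm_num) (by norm_num) _
  calc (3 : ℝ) ^ ω d * ∏ p ∈ d.primeFactors, (polyRootCountMod ![F] p : ℝ)
      ≤ (2 ^ 2) ^ ω d * (2 ^ F.natDegree) ^ ω d :=
        mul_le_mul h4 (h1.trans h3) (Finset.prod_nonneg fun _ _ => Nat.cast_nonneg _) (by positivity)
    _ = ((2 : ℝ) ^ ω d) ^ (F.natDegree + 2) := by
        rw [← pow_mul, ← pow_mul, ← pow_mul, ← pow_add]; ring_nf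

/-- **Remainder sum**: `∑_{d ∣ P, d ≤ Y} 3^{ω(d)} ρ_F(d) ≤ C_{deg F} · Y (log Y)^{2^{deg F + 3}}` for
square-free `P` and `Y ≥ 2`, with `C` depending only on `deg F`. [folklore] -/
private theorem exists_sum_three_pow_rootCount_le (g : ℕ) :
    ∃ C : ℝ, 0 < C ∧ ∀ (F : ℤ[X]), F.natDegree = g →
      (∀ p : ℕ, p.Prime → polyRootCountMod ![F] p < p) →
        ∀ (P : ℕ), Squarefree P → ∀ (Y : ℝ), 2 ≤ Y →
          ∑ d ∈ P.divisors.filter (fun d : ℕ => (d : ℝ) ≤ Y),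
              (3 : ℝ) ^ ω d * (polyRootCountMod ![F] d : ℝ) ≤ C * Y * Real.log Y ^ (2 ^ (g + 3)) := by
  obtain ⟨C, hC, hsum⟩ := exists_sum_sigma_zero_pow_le_real (g + 2)
  refine ⟨C, hC, fun F hF hρlt P hP Y hY => ?_⟩
  have hsub : P.divisors.filter (fun d : ℕ => (d : ℝ) ≤ Y) ⊆ Icc 1 ⌊Y⌋₊ := by
    intro d hd
    rw [Finset.mem_filter] at hd
    have hd0 : 0 < d := Nat.pos_of_mem_divisors hd.1
    exact Finset.mem_Icc.mpr ⟨hd0, Nat.le_floor hd.2⟩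
  calc ∑ d ∈ P.divisors.filter (fun d : ℕ => (d : ℝ) ≤ Y), (3 : ℝ) ^ ω d * (polyRootCountMod ![F] d : ℝ)
      ≤ ∑ d ∈ P.divisors.filter (fun d : ℕ => (d : ℝ) ≤ Y), (σ 0 d : ℝ) ^ (g + 2) := by
        refine Finset.sum_le_sum fun d hd => ?_
        have hdP : d ∣ P := Nat.dvd_of_mem_divisors (Finset.mem_filter.mp hd).1
        have hdsq : Squarefree d := hP.squarefree_of_dvd hdP
        rw [← hF]
        exact three_pow_mul_rootCount_le F hρlt hdsq
    _ ≤ ∑ d ∈ Icc 1 ⌊Y⌋₊, (σ 0 d : ℝ) ^ (g + 2) :=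
        Finset.sum_le_sum_of_subset_of_nonneg hsub fun _ _ _ => by positivity
    _ ≤ C * Y * Real.log Y ^ (2 ^ (g + 2 + 1)) := hsum Y hY
    _ = C * Y * Real.log Y ^ (2 ^ (g + 3)) := by norm_num

/-! ### The van Lint–Richert minorant of Selberg's sum, for densities vanishing at some primes -/

/-- `∑_{j=1}^{K} t^j ≤ t/(1 − t)` for `0 ≤ t < 1`. [folklore] -/
private theorem sum_Icc_pow_le {t : ℝ} (ht0 : 0 ≤ t) (ht1 : t < 1) (K : ℕ) :
    ∑ j ∈ Icc 1 K, t ^ j ≤ t / (1 - t) := by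
  have h1t : 0 < 1 - t := by linarith
  have heq : ∑ j ∈ Icc 1 K, t ^ j = t * ∑ i ∈ Finset.range K, t ^ i := by
    have : Icc 1 K = Ico 1 (K + 1) := rfl
    rw [this, Finset.sum_Ico_eq_sum_range, Finset.mul_sum]
    simp only [add_tsub_cancel_right]
    refine Finset.sum_congr rfl fun i _ => ?_
    rw [pow_add, pow_one]
  rw [heq, le_div_iff₀ h1t]
  have hgeom : (∑ i ∈ Finset.range K, t ^ i) * (1 - t) = 1 - t ^ K := by
    have := geom_sum_mul_neg t K
    linarith [this]
  calc t * (∑ i ∈ Finset.range K, t ^ i) * (1 - t) = t * (1 - t ^ K) := by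
        rw [mul_assoc, hgeom]
    _ ≤ t := by
        have : 0 ≤ t ^ K := pow_nonneg ht0 K
        nlinarith

/-- The minorant is multiplicative as an arithmetic function. [folklore] -/
private theorem isMultiplicative_cm_mk (a : ℕ → ℝ) :
    ArithmeticFunction.IsMultiplicative (⟨cm a, cm_zero a⟩ : ArithmeticFunction ℝ) :=
  ⟨cm_one a, fun {m n} _ => by simp only [ArithmeticFunction.coe_mk, cm_mul a m n]⟩

/-- `f̃(p^j) = f̃(p)^j`. [folklore] -/
private theorem cm_prime_pow (a : ℕ → ℝ) (p j : ℕ) : cm a (p ^ j) = cm a p ^ j := by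
  rw [← cmHom_apply, ← cmHom_apply, map_pow]

/-- **`∑_{n ≤ w} f̃(n) ≤ G(√D)`** for a Selberg sieve `S` of level `D ≥ w²` whose sifting range contains
every prime `p ≤ w` with `a(p) ≠ 0` and whose density is `a` on the sifting primes; here
`f̃ = cm a` with `0 ≤ a(p) < 1` (van Lint–Richert; the primes with `a(p) = 0` contribute nothing on
either side). [cite: HalberstamRichert1974, Ch. 3 §1, (1.12)] -/
private theorem sum_cm_le_selbergSum (S : SelbergSieve) {a : ℕ → ℝ} (ha0 : ∀ p, 0 ≤ a p)
    (ha1 : ∀ p, p.Prime → a p < 1) {w K : ℕ} (hwK : w < 2 ^ (K + 1)) (hD : (w : ℝ) ^ 2 ≤ S.level)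
    (hP : ∀ p, p.Prime → p ≤ w → a p ≠ 0 → p ∣ S.prodPrimes)
    (hnu : ∀ p, p.Prime → p ∣ S.prodPrimes → S.nu p = a p) :
    ∑ n ∈ Ioc 0 w, cm a n ≤ S.selbergSum := by
  classical
  set h : ℕ → ℝ := fun p => if p ∣ S.prodPrimes then S.selbergTerms p else 0 with hh_def
  -- the hypothesis of the radical expansion
  have hh : ∀ p, p.Prime → p ≤ w →
      ∑ j ∈ Icc 1 K, (⟨cm a, cm_zero a⟩ : ArithmeticFunction ℝ) (p ^ j) ≤ h p := by
    intro p hp hpw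
    show ∑ j ∈ Icc 1 K, cm a (p ^ j) ≤ h p
    simp only [cm_prime_pow, cm_prime a hp]
    by_cases hdvd : p ∣ S.prodPrimes
    · rw [hh_def]; simp only; rw [if_pos hdvd, BoundingSieve.selbergTerms_apply, hp.primeFactors,
        Finset.prod_singleton, hnu p hp hdvd]
      have := sum_Icc_pow_le (ha0 p) (ha1 p hp) K
      rw [div_eq_mul_inv] at this
      exact this
    · have ha : a p = 0 := by
        by_contra hne; exact hdvd (hP p hp hpw hne)
      rw [hh_def]; simp only; rw [if_neg hdvd, ha]
      refine (Finset.sum_eq_zero fun j hj => ?_).le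
      rw [Finset.mem_Icc] at hj
      exact zero_pow (by omega)
  have h1 : ∑ n ∈ Ioc 0 w, cm a n ≤ ∑ l ∈ (Ioc 0 w).filter Squarefree, ∏ p ∈ l.primeFactors, h p :=
    sum_le_sum_squarefree_prod_of_multiplicative (isMultiplicative_cm_mk a)
      (fun n => cm_nonneg ha0 n) hwK hh
  refine h1.trans ?_
  -- termwise: `∏_{p ∣ l} h(p) = [l ∣ P] g(l)` for square-free `l`
  have hterm : ∀ l ∈ (Ioc 0 w).filter Squarefree, ∏ p ∈ l.primeFactors, h p =
      if l ∣ S.prodPrimes then S.selbergTerms l else 0 := by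
    intro l hl
    rw [Finset.mem_filter] at hl
    have hlsq := hl.2
    by_cases hlP : l ∣ S.prodPrimes
    · rw [if_pos hlP, selbergTerms_eq_prod S.toBoundingSieve hlsq]
      refine Finset.prod_congr rfl fun p hp => ?_
      rw [hh_def]; simp only
      rw [if_pos ((Nat.dvd_of_mem_primeFactors hp).trans hlP)]
    · rw [if_neg hlP]
      -- some prime factor of `l` does not divide `P`
      have : ∃ p ∈ l.primeFactors, ¬ p ∣ S.prodPrimes := by
        by_contra hall
        push Not at hall
        apply hlP
        rw [← Nat.prod_primeFactors_of_squarefree hlsq]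
        exact Finset.prod_primes_dvd _ (fun p hp => (Nat.prime_of_mem_primeFactors hp).prime) hall
      obtain ⟨p, hp, hpP⟩ := this
      refine Finset.prod_eq_zero hp ?_
      rw [hh_def]; simp only; rw [if_neg hpP]
  rw [Finset.sum_congr rfl hterm, ← Finset.sum_filter, SelbergSieve.selbergSum]
  refine Finset.sum_le_sum_of_subset_of_nonneg (fun l hl => ?_) fun l hl _ =>
    (BoundingSieve.selbergTerms_pos (Nat.dvd_of_mem_divisors (Finset.mem_filter.mp hl).1)).le
  rw [Finset.mem_filter, Finset.mem_filter, Finset.mem_Ioc] at hl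
  rw [Finset.mem_filter, Nat.mem_divisors]
  refine ⟨⟨hl.2, BoundingSieve.prodPrimes_ne_zero⟩, ?_⟩
  have : (l : ℝ) ≤ w := by exact_mod_cast hl.1.1.2
  exact le_trans (pow_le_pow_left₀ (Nat.cast_nonneg l) this 2) hD

/-! ### Selberg's upper bound for `P_f(x)` at the parity constant -/

/-- Choice of the small parameter: for `ε' > 0` there is `η ∈ (0, 1/4]` with
`1 ≤ (1 + ε')(1 − η)^{2k+1}`. [folklore] -/
private theorem exists_eta (k : ℕ) {ε' : ℝ} (hε' : 0 < ε') :
    ∃ η : ℝ, 0 < η ∧ η ≤ 1 / 4 ∧ 1 ≤ (1 + ε') * (1 - η) ^ (2 * k + 1) := by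
  have hcont : ContinuousAt (fun η : ℝ => (1 + ε') * (1 - η) ^ (2 * k + 1)) 0 :=
    (continuousAt_const.mul ((continuousAt_const.sub continuousAt_id).pow _))
  have h1 : (1 : ℝ) < (1 + ε') * (1 - 0) ^ (2 * k + 1) := by
    rw [sub_zero, one_pow, mul_one]; linarith
  have hmem : {η : ℝ | 1 < (1 + ε') * (1 - η) ^ (2 * k + 1)} ∈ 𝓝 (0 : ℝ) :=
    hcont.preimage_mem_nhds (Ioi_mem_nhds h1)
  obtain ⟨r, hr0, hr⟩ := Metric.mem_nhds_iff.mp hmem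
  refine ⟨min (r / 2) (1 / 4), by positivity, min_le_right _ _, le_of_lt (hr ?_)⟩
  rw [Metric.mem_ball, Real.dist_eq, sub_zero, abs_of_pos (by positivity)]
  exact lt_of_le_of_lt (min_le_left _ _) (by linarith)

set_option maxHeartbeats 800000 in
/-- **Selberg's upper bound for a Bateman–Horn system at the parity constant** (the source's §2.3.3
Theorem 4 with the constant `2^k k!`; Diamond–Halberstam–Galway Cor. 5.7 / (5.47)): for every
Bateman–Horn system `f` of `k` integer polynomials and every `ε > 0`,
`P_f(x) ≤ (2^k k! + ε) · C(f) · x/(log x)^k` for all sufficiently large `x`, where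
`C(f) = batemanHornConst f`. Proof: Selberg's `Λ²` sieve (tree
`SelbergSieve.siftedSum_le_totalMass_div_selbergSum_add_holds`) on the values `∏ fᵢ(m + n₀)`,
`1 ≤ m ≤ x`, sifted by the primes `p ≤ w = ⌊x^{(1−η)/2}⌋` with `ω_f(p) ≠ 0`, level `D = w²`;
`G(√D) ≥ ∑_{n ≤ w} f̃(n) ≥ (1 − η)(log w)^k/(k! C(f))` (van Lint–Richert and Part A);
remainder `∑_{d ≤ D} 3^{ν(d)} ρ_F(d) ≪ D (log D)^K = o(x/(log x)^k)`.
[cite: Greaves2001, §2.3.3 Theorem 4] -/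
theorem polyPrimeCount_le_selbergSieve {f : Fin k → ℤ[X]} (hf : IsBatemanHornSystem f) {ε : ℝ}
    (hε : 0 < ε) :
    ∀ᶠ x : ℕ in atTop,
      (polyPrimeCount f x : ℝ) ≤
        (2 ^ k * (k.factorial : ℝ) + ε) * batemanHornConst f * (x : ℝ) / Real.log x ^ k := by
  classical
  -- constants
  set M₀ : ℝ := 2 ^ k * (k.factorial : ℝ) with hM₀
  have hM₀pos : 0 < M₀ := by positivity
  have hbh := IsBatemanHornSystem.hasBatemanHornConst_holds hf
  set C : ℝ := batemanHornConst f with hCdef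
  have hCpos : 0 < C := hbh.2
  set ε' : ℝ := ε / (2 * M₀) with hε'
  have hε'0 : 0 < ε' := by positivity
  obtain ⟨η, hη0, hη4, hη⟩ := exists_eta k hε'0
  set θ : ℝ := (1 - η) / 2 with hθ
  have hθ0 : 0 < θ := by rw [hθ]; linarith
  have hθ1 : θ < 1 := by rw [hθ]; linarith
  have h1θ : 0 < 1 - θ := by linarith
  -- degrees, `n₀`, the shifted product polynomial `F`
  have hdpos' : ∀ i, 0 < (f i).natDegree := hf.natDegree_pos
  have hn₀i : ∀ i, ∃ N₀ : ℕ, ∀ n : ℕ, N₀ ≤ n → 1 ≤ (f i).eval (n : ℤ) := by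
    intro i
    obtain ⟨N₀, hN₀⟩ := Literature.Barriers.Parity.exists_forall_le_eval_of_leadingCoeff_pos
      (hdpos' i) (hf.leadingCoeff_pos i) 1
    exact ⟨N₀, fun n hn => by exact_mod_cast hN₀ n hn⟩
  choose N₀ hN₀ using hn₀i
  set n₀ : ℕ := Finset.univ.sup N₀ with hn₀_def
  have hn₀ : ∀ i, ∀ n : ℕ, n₀ ≤ n → 1 ≤ (f i).eval (n : ℤ) := fun i n hn =>
    hN₀ i n ((Finset.le_sup (f := N₀) (mem_univ i)).trans hn)
  set G₀ : ℤ[X] := ∏ i, f i with hG₀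
  set F : ℤ[X] := G₀.comp (X + Polynomial.C (n₀ : ℤ)) with hF
  set Ddeg : ℝ := ∑ i, ((f i).natDegree : ℝ) with hDdeg
  have hDdeg0 : 0 ≤ Ddeg := by rw [hDdeg]; positivity
  have hFeval : ∀ m : ℕ, F.eval (m : ℤ) = ∏ i, (f i).eval ((m : ℤ) + n₀) := fun m => by
    simp [hF, hG₀, eval_comp, eval_prod]
  have hρF : ∀ p, polyRootCountMod ![F] p = polyRootCountMod f p := fun p => by
    rw [hF, Literature.Barriers.Parity.polyRootCountMod_comp_X_add_C, hG₀,
      ← PolyPrimeCountBrun.polyRootCountMod_eq_single_prod]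
  have hρlt : ∀ p, p.Prime → polyRootCountMod ![F] p < p := fun p hp => by
    rw [hρF]; exact hf.hasNoFixedPrimeDivisor p hp
  have hFpos : ∀ m : ℕ, 0 < F.eval (m : ℤ) := fun m => by
    rw [hFeval]
    exact prod_pos fun i _ => by
      have := hn₀ i (m + n₀) (Nat.le_add_left _ _)
      push_cast at this
      linarith
  have hdensF : ∀ p, rootDensity F p = dens f p := fun p => by
    rw [rootDensity_apply, hρF, dens]
  -- the remainder constant
  obtain ⟨CR, hCR0, hCR⟩ := exists_sum_three_pow_rootCount_le F.natDegree
  set K' : ℕ := 2 ^ (F.natDegree + 3) with hK'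
  -- eventualities
  have ha_tend : Tendsto (fun x : ℕ => (x : ℝ) ^ θ) atTop atTop :=
    (tendsto_rpow_atTop hθ0).comp tendsto_natCast_atTop_atTop
  have hw_tend : Tendsto (fun x : ℕ => ⌊(x : ℝ) ^ θ⌋₊) atTop atTop :=
    tendsto_nat_floor_atTop.comp ha_tend
  have hlow0 : 0 < (1 - η) * (C⁻¹ / k.factorial) := by
    have : 0 < 1 - η := by linarith
    positivity
  have E1 : ∀ᶠ x : ℕ in atTop, (1 - η) * (C⁻¹ / k.factorial) *
      Real.log ((⌊(x : ℝ) ^ θ⌋₊ : ℕ) : ℝ) ^ k ≤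
        ∑ n ∈ Finset.range (⌊(x : ℝ) ^ θ⌋₊ + 1), cm (dens f) n := by
    have h := (tendsto_sum_cm_div_log_pow hf).comp (tendsto_natCast_atTop_atTop.comp hw_tend)
    have hlt : (1 - η) * (C⁻¹ / k.factorial) < C⁻¹ / k.factorial := by
      have h0 : 0 < C⁻¹ / (k.factorial : ℝ) := by positivity
      have := mul_lt_mul_of_pos_right (by linarith : 1 - η < 1) h0
      rwa [one_mul] at this
    have h2 := h.eventually_const_lt hlt
    filter_upwards [h2, hw_tend.eventually_ge_atTop 2] with x hx hw2
    simp only [Function.comp_apply, Nat.floor_natCast] at hx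
    have hlog : 0 < Real.log ((⌊(x : ℝ) ^ θ⌋₊ : ℕ) : ℝ) ^ k :=
      pow_pos (Real.log_pos (by exact_mod_cast (by omega : 1 < ⌊(x : ℝ) ^ θ⌋₊))) k
    exact (le_div_iff₀ hlog).mp hx.le
  have Ea : ∀ᶠ x : ℕ in atTop, (4 : ℝ) ≤ (x : ℝ) ^ θ := ha_tend.eventually_ge_atTop 4
  have Eb : ∀ᶠ x : ℕ in atTop, Real.log 2 ≤ η * θ * Real.log x := by
    have h : Tendsto (fun x : ℕ => η * θ * Real.log x) atTop atTop :=
      (Real.tendsto_log_atTop.comp tendsto_natCast_atTop_atTop).const_mul_atTop (by positivity)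
    exact h.eventually_ge_atTop _
  -- remainder and junk are `o(x/(log x)^k)`
  have E3 : ∀ᶠ x : ℕ in atTop,
      CR * (x : ℝ) ^ (1 - η) * Real.log x ^ K' ≤ ε / 4 * C * (x : ℝ) / Real.log x ^ k := by
    have hlo := isLittleO_log_rpow_rpow_atTop ((K' + k : ℕ) : ℝ) hη0
    have hc : 0 < ε / 4 * C / CR := by positivity
    have hreal : ∀ᶠ x : ℝ in atTop,
        CR * x ^ (1 - η) * Real.log x ^ K' ≤ ε / 4 * C * x / Real.log x ^ k := by
      filter_upwards [hlo.bound hc, eventually_gt_atTop (1 : ℝ)] with x hx hx1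
      have hx0 : 0 < x := by linarith
      have hlog : 0 < Real.log x := Real.log_pos hx1
      rw [Real.norm_of_nonneg (Real.rpow_nonneg hlog.le _),
        Real.norm_of_nonneg (Real.rpow_nonneg hx0.le _), Real.rpow_natCast] at hx
      -- hx : log x ^ (K'+k) ≤ ε/4*C/CR * x^η
      rw [le_div_iff₀ (pow_pos hlog k)]
      have h1 : CR * Real.log x ^ (K' + k) ≤ ε / 4 * C * x ^ η := by
        have := mul_le_mul_of_nonneg_left hx hCR0.le
        have e : CR * (ε / 4 * C / CR * x ^ η) = ε / 4 * C * x ^ η := by field_simp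
        linarith
      have hsplit : x = x ^ (1 - η) * x ^ η := by
        rw [← Real.rpow_add hx0]; norm_num
      calc CR * x ^ (1 - η) * Real.log x ^ K' * Real.log x ^ k
          = x ^ (1 - η) * (CR * Real.log x ^ (K' + k)) := by rw [pow_add]; ring
        _ ≤ x ^ (1 - η) * (ε / 4 * C * x ^ η) :=
            mul_le_mul_of_nonneg_left h1 (Real.rpow_nonneg hx0.le _)
        _ = ε / 4 * C * x := by
            conv_rhs => rw [hsplit]
            ring
    exact tendsto_natCast_atTop_atTop.eventually hreal
  set KJ : ℝ := ((n₀ + 1 : ℕ) : ℝ) + 3 * Ddeg with hKJ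
  have hKJ0 : 0 < KJ := by positivity
  have E4 : ∀ᶠ x : ℕ in atTop,
      KJ * (x : ℝ) ^ θ ≤ ε / 4 * C * (x : ℝ) / Real.log x ^ k := by
    have hlo := isLittleO_log_rpow_rpow_atTop (k : ℝ) h1θ
    have hc : 0 < ε / 4 * C / KJ := by positivity
    have hreal : ∀ᶠ x : ℝ in atTop, KJ * x ^ θ ≤ ε / 4 * C * x / Real.log x ^ k := by
      filter_upwards [hlo.bound hc, eventually_gt_atTop (1 : ℝ)] with x hx hx1
      have hx0 : 0 < x := by linarith
      have hlog : 0 < Real.log x := Real.log_pos hx1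
      rw [Real.norm_of_nonneg (Real.rpow_nonneg hlog.le _),
        Real.norm_of_nonneg (Real.rpow_nonneg hx0.le _), Real.rpow_natCast] at hx
      rw [le_div_iff₀ (pow_pos hlog k)]
      have h1 : KJ * Real.log x ^ k ≤ ε / 4 * C * x ^ (1 - θ) := by
        have := mul_le_mul_of_nonneg_left hx hKJ0.le
        have e : KJ * (ε / 4 * C / KJ * x ^ (1 - θ)) = ε / 4 * C * x ^ (1 - θ) := by field_simp
        linarith
      have hsplit : x = x ^ θ * x ^ (1 - θ) := by
        rw [← Real.rpow_add hx0]; norm_num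
      calc KJ * x ^ θ * Real.log x ^ k = x ^ θ * (KJ * Real.log x ^ k) := by ring
        _ ≤ x ^ θ * (ε / 4 * C * x ^ (1 - θ)) :=
            mul_le_mul_of_nonneg_left h1 (Real.rpow_nonneg hx0.le _)
        _ = ε / 4 * C * x := by
            conv_rhs => rw [hsplit]
            ring
    exact tendsto_natCast_atTop_atTop.eventually hreal
  filter_upwards [E1, Ea, Eb, E3, E4, eventually_gt_atTop 1] with x h1 ha4 hb h3 h4 hx1
  -- parameters at height `x`
  have hx1R : (1 : ℝ) < x := by exact_mod_cast hx1
  have hx0 : (0 : ℝ) < x := by linarith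
  have hlogx : 0 < Real.log x := Real.log_pos hx1R
  set a : ℝ := (x : ℝ) ^ θ with ha
  set w : ℕ := ⌊a⌋₊ with hw
  set zN : ℕ := w + 1 with hzN
  set z : ℝ := (zN : ℝ) with hz
  set Dlev : ℝ := (w : ℝ) ^ 2 with hDlev
  have ha0 : 0 ≤ a := by linarith
  have hw4 : 4 ≤ w := Nat.le_floor (by exact_mod_cast ha4)
  have hwa : (w : ℝ) ≤ a := Nat.floor_le ha0
  have haw : a < w + 1 := Nat.lt_floor_add_one a
  have hw2R : (2 : ℝ) ≤ w := by exact_mod_cast (by omega : 2 ≤ w)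
  have hw0 : (0 : ℝ) < w := by linarith
  have hax : a ≤ x := by
    calc a = (x : ℝ) ^ θ := ha
      _ ≤ (x : ℝ) ^ (1 : ℝ) := Real.rpow_le_rpow_of_exponent_le hx1R.le hθ1.le
      _ = x := Real.rpow_one _
  have hDlev1 : (1 : ℝ) ≤ Dlev := by rw [hDlev]; exact one_le_pow₀ (by linarith)
  have hDlev2 : (2 : ℝ) ≤ Dlev := by
    rw [hDlev]; exact hw2R.trans (le_self_pow₀ (by linarith) two_ne_zero)
  have hDlevx : Dlev ≤ (x : ℝ) ^ (1 - η) := by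
    have : Dlev ≤ a ^ 2 := by rw [hDlev]; exact pow_le_pow_left₀ hw0.le hwa 2
    refine this.trans (le_of_eq ?_)
    rw [ha, ← Real.rpow_natCast, ← Real.rpow_mul hx0.le, hθ]
    congr 1; push_cast; ring
  have hDlevx' : Dlev ≤ x := hDlevx.trans (by
    calc (x : ℝ) ^ (1 - η) ≤ (x : ℝ) ^ (1 : ℝ) :=
          Real.rpow_le_rpow_of_exponent_le hx1R.le (by linarith)
      _ = x := Real.rpow_one _)
  -- `log w ≥ (1 - η) θ log x`
  have hlogw : (1 - η) * θ * Real.log x ≤ Real.log w := by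
    have hwhalf : a / 2 ≤ w := by linarith
    have hloga : Real.log a = θ * Real.log x := by rw [ha, Real.log_rpow hx0]
    have h1 : Real.log (a / 2) ≤ Real.log w := Real.log_le_log (by linarith) hwhalf
    rw [Real.log_div (by linarith) (by norm_num), hloga] at h1
    have e : (1 - η) * θ * Real.log x = θ * Real.log x - η * θ * Real.log x := by ring
    linarith
  have hlogw0 : 0 < Real.log w := Real.log_pos (by linarith)
  -- the sifted set: reduction and monotonicity in the sifting range
  have hz0 : (0 : ℝ) ≤ z := by rw [hz]; positivity
  have hQ := PolyPrimeCountBrun.polyPrimeCount_le_card_coprime_add f n₀ hn₀ hdpos' x hz0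
  set P' : ℕ := ∏ p ∈ (Nat.primesBelow zN).filter (fun p => polyRootCountMod ![F] p ≠ 0), p
    with hP'
  have hprimes' : ∀ p ∈ (Nat.primesBelow zN).filter (fun p => polyRootCountMod ![F] p ≠ 0),
      p.Prime := fun p hp => (Nat.mem_primesBelow.mp (Finset.mem_filter.mp hp).1).2
  have hP'dvd : P' ∣ primesProdBelow z := by
    rw [hP', primesProdBelow, hz, Nat.ceil_natCast]
    exact Finset.prod_dvd_prod_of_subset _ _ _ (Finset.filter_subset _ _)
  have hP'sq : Squarefree P' := (squarefree_primesProdBelow z).squarefree_of_dvd hP'dvd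
  have hP'0 : P' ≠ 0 := hP'sq.ne_zero
  have hP'fac : P'.primeFactors = (Nat.primesBelow zN).filter (fun p => polyRootCountMod ![F] p ≠ 0) := by
    rw [hP']; exact Nat.primeFactors_prod hprimes'
  have hmemP' : ∀ {p : ℕ}, p.Prime → (p ∣ P' ↔ p < zN ∧ polyRootCountMod ![F] p ≠ 0) := by
    intro p hp
    constructor
    · intro hd
      have : p ∈ P'.primeFactors := (Nat.mem_primeFactors_of_ne_zero hP'0).mpr ⟨hp, hd⟩
      rw [hP'fac, Finset.mem_filter, Nat.mem_primesBelow] at this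
      exact ⟨this.1.1, this.2⟩
    · rintro ⟨h1', h2'⟩
      rw [hP']
      exact Finset.dvd_prod_of_mem _ (Finset.mem_filter.mpr ⟨Nat.mem_primesBelow.mpr ⟨h1', hp⟩, h2'⟩)
  set T₁ := (Ioc 0 x).filter fun m : ℕ => (F.eval (m : ℤ)).natAbs.Coprime (primesProdBelow z)
    with hT₁
  set T₂ := (Ioc 0 x).filter fun m : ℕ => (F.eval (m : ℤ)).natAbs.Coprime P' with hT₂
  have hT₁₂ : #T₁ ≤ #T₂ := by
    refine Finset.card_le_card (Finset.monotone_filter_right _ fun m _ hm => ?_)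
    exact Nat.Coprime.of_dvd_right hP'dvd hm
  -- the sieve sequence and Selberg's bound
  set A := polyAPSeq F x 1 0 with hA
  set xx : ℝ := ∑ m ∈ Ioc 0 x, ((F.eval (m : ℤ) : ℤ) : ℝ) with hxx
  have hxb : ∀ m ∈ apIndex x 1 0, 0 < F.eval (m : ℤ) ∧ ((F.eval (m : ℤ) : ℤ) : ℝ) ≤ xx := by
    intro m hm
    rw [apIndex_one, mem_Ioc] at hm
    refine ⟨hFpos m, ?_⟩
    rw [hxx]
    exact single_le_sum (f := fun m : ℕ => ((F.eval (m : ℤ) : ℤ) : ℝ)) (fun n _ => by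
      exact_mod_cast (hFpos n).le) (mem_Ioc.mpr hm)
  have hsift : A.IsSiftable P' := by
    intro p hp hpd
    have hmem := (hmemP' hp).mp hpd
    rw [hA, polyAPSeq_density, rootDensity_apply]
    have hp0 : (0 : ℝ) < p := by exact_mod_cast hp.pos
    constructor
    · have : (0 : ℝ) < polyRootCountMod ![F] p := by
        exact_mod_cast Nat.pos_of_ne_zero hmem.2
      positivity
    · rw [div_lt_one hp0]; exact_mod_cast hρlt p hp
  let S : SelbergSieve := ⟨A.toBoundingSieve xx hP'sq hsift, Dlev, hDlev1⟩
  have hSel := SelbergSieve.siftedSum_le_totalMass_div_selbergSum_add_holds S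
  have hSsift : S.siftedSum = #T₂ := by
    change (A.toBoundingSieve xx hP'sq hsift).siftedSum = _
    rw [SieveSequence.siftedSum_toBoundingSieve, hA, polyAPSeq_sifted F x 1 0 hxb, apIndex_one]
  have hSmass : S.totalMass = x := by
    change A.size xx = _
    rw [hA, polyAPSeq_size, Nat.cast_one, div_one]
  have hSrem : ∀ d, S.rem d = A.remainder d xx := fun d =>
    SieveSequence.toBoundingSieve_rem A xx hP'sq hsift d
  have hSP : S.prodPrimes = P' := rfl
  have hSlevel : S.level = Dlev := rfl
  have hSnu : ∀ p, S.nu p = rootDensity F p := fun p => rfl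
  -- the main term: `G(√D) ≥ ∑_{n ≤ w} f̃(n) ≥ (1-η) (log w)^k/(k! C)`
  have hG : ∑ n ∈ Ioc 0 w, cm (dens f) n ≤ S.selbergSum := by
    refine sum_cm_le_selbergSum S (dens_nonneg f) (fun p hp => dens_lt_one hf hp)
      (K := w) (Nat.lt_two_pow_self.trans (Nat.pow_lt_pow_right (by norm_num) (Nat.lt_succ_self w)))
      (by rw [hSlevel, hDlev]) (fun p hp hpw hne => ?_)
      (fun p hp _ => by rw [hSnu, hdensF])
    rw [hSP, hmemP' hp]
    refine ⟨by omega, ?_⟩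
    rw [hρF]
    intro h0
    apply hne
    rw [dens, h0, Nat.cast_zero, zero_div]
  have hsum_range : ∑ n ∈ Finset.range (w + 1), cm (dens f) n = ∑ n ∈ Ioc 0 w, cm (dens f) n := by
    rw [Finset.range_eq_Ico, Finset.sum_eq_sum_Ico_succ_bot (Nat.succ_pos w), cm_zero, zero_add]
    refine Finset.sum_congr ?_ fun _ _ => rfl
    ext n
    simp only [Finset.mem_Ico, Finset.mem_Ioc]
    omega
  have hGlow : (1 - η) * (C⁻¹ / k.factorial) * Real.log w ^ k ≤ S.selbergSum := by
    have := h1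
    rw [hsum_range] at this
    exact this.trans hG
  have hGpos : 0 < S.selbergSum := SelbergSieve.selbergSum_pos S
  have hlowpos : 0 < (1 - η) * (C⁻¹ / k.factorial) * Real.log w ^ k :=
    mul_pos hlow0 (pow_pos hlogw0 k)
  have h1η : 0 < 1 - η := by linarith
  have hpos3 : 0 < (1 - η) * θ * Real.log x := mul_pos (mul_pos h1η hθ0) hlogx
  have hc12 : 0 < (1 - η) * (C⁻¹ / k.factorial) * ((1 - η) * θ) ^ k :=
    mul_pos hlow0 (pow_pos (mul_pos h1η hθ0) k)
  have hkey : 1 / ((1 - η) * (C⁻¹ / k.factorial) * ((1 - η) * θ) ^ k) ≤ (M₀ + ε / 2) * C := by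
    rw [div_le_iff₀ hc12]
    have e : (M₀ + ε / 2) * C * ((1 - η) * (C⁻¹ / k.factorial) * ((1 - η) * θ) ^ k) =
        (1 + ε') * (1 - η) ^ (2 * k + 1) := by
      have e1 : ((1 - η) * θ) ^ k = (1 - η) ^ (2 * k) / 2 ^ k := by
        rw [hθ, pow_mul, ← div_pow]
        congr 1
        ring
      rw [e1, hε', hM₀]
      have hC0 : C ≠ 0 := hCpos.ne'
      have hk0 : (k.factorial : ℝ) ≠ 0 := by positivity
      field_simp
      ring
    rw [e]
    exact hη
  have hmain : S.totalMass / S.selbergSum ≤ (M₀ + ε / 2) * C * x / Real.log x ^ k := by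
    rw [hSmass]
    calc (x : ℝ) / S.selbergSum ≤ x / ((1 - η) * (C⁻¹ / k.factorial) * Real.log w ^ k) :=
          div_le_div_of_nonneg_left hx0.le hlowpos hGlow
      _ ≤ x / ((1 - η) * (C⁻¹ / k.factorial) * ((1 - η) * θ * Real.log x) ^ k) := by
          refine div_le_div_of_nonneg_left hx0.le ?_ ?_
          · exact mul_pos hlow0 (pow_pos hpos3 k)
          · exact mul_le_mul_of_nonneg_left (pow_le_pow_left₀ hpos3.le hlogw k) hlow0.le
      _ = x / Real.log x ^ k * (1 / ((1 - η) * (C⁻¹ / k.factorial) * ((1 - η) * θ) ^ k)) := by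
          rw [div_mul_div_comm, mul_one, mul_pow]
          congr 1
          ring
      _ ≤ x / Real.log x ^ k * ((M₀ + ε / 2) * C) :=
          mul_le_mul_of_nonneg_left hkey (by positivity)
      _ = (M₀ + ε / 2) * C * x / Real.log x ^ k := by ring
  -- the remainder
  have hR : ∑ d ∈ S.prodPrimes.divisors.filter (fun d : ℕ => (d : ℝ) ≤ S.level),
      (3 : ℝ) ^ ω d * |S.rem d| ≤ ε / 4 * C * x / Real.log x ^ k := by
    rw [hSP, hSlevel]
    calc ∑ d ∈ P'.divisors.filter (fun d : ℕ => (d : ℝ) ≤ Dlev), (3 : ℝ) ^ ω d * |S.rem d|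
        ≤ ∑ d ∈ P'.divisors.filter (fun d : ℕ => (d : ℝ) ≤ Dlev),
            (3 : ℝ) ^ ω d * (polyRootCountMod ![F] d : ℝ) := by
          refine Finset.sum_le_sum fun d hd => ?_
          have hd0 : 0 < d := Nat.pos_of_mem_divisors (Finset.mem_filter.mp hd).1
          rw [hSrem]
          exact mul_le_mul_of_nonneg_left
            (abs_remainder_polyAPSeq_le F Nat.one_pos hd0 (Nat.coprime_one_left d) hxb)
            (by positivity)
      _ ≤ CR * Dlev * Real.log Dlev ^ K' := hCR F rfl hρlt P' hP'sq Dlev hDlev2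
      _ ≤ CR * (x : ℝ) ^ (1 - η) * Real.log x ^ K' := by
          have hlogD : Real.log Dlev ≤ Real.log x := Real.log_le_log (by linarith) hDlevx'
          have hlogD0 : 0 ≤ Real.log Dlev := Real.log_nonneg hDlev1
          gcongr
      _ ≤ ε / 4 * C * x / Real.log x ^ k := h3
  -- the junk terms of the reduction
  have hjunk : ((n₀ + 1 : ℕ) : ℝ) + Ddeg * (z + 1) ≤ ε / 4 * C * x / Real.log x ^ k := by
    have hz' : z + 1 ≤ 3 * a := by
      rw [hz, hzN]; push_cast; linarith
    have ha1 : 1 ≤ a := by linarith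
    calc ((n₀ + 1 : ℕ) : ℝ) + Ddeg * (z + 1) ≤ ((n₀ + 1 : ℕ) : ℝ) * a + Ddeg * (3 * a) := by
          gcongr
          exact le_mul_of_one_le_right (by positivity) ha1
      _ = KJ * a := by rw [hKJ]; ring
      _ ≤ ε / 4 * C * x / Real.log x ^ k := h4
  -- assembly
  have hS2 : (#T₂ : ℝ) ≤ (M₀ + ε / 2) * C * x / Real.log x ^ k + ε / 4 * C * x / Real.log x ^ k := by
    rw [← hSsift]
    exact hSel.trans (add_le_add hmain hR)
  have hT : (#T₁ : ℝ) ≤ #T₂ := by exact_mod_cast hT₁₂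
  have hfin : (polyPrimeCount f x : ℝ) ≤
      ε / 4 * C * x / Real.log x ^ k +
        ((M₀ + ε / 2) * C * x / Real.log x ^ k + ε / 4 * C * x / Real.log x ^ k) := by
    have hQ' : (polyPrimeCount f x : ℝ) ≤ ((n₀ + 1 : ℕ) : ℝ) + #T₁ + Ddeg * (z + 1) := hQ
    linarith
  calc (polyPrimeCount f x : ℝ) ≤ _ := hfin
    _ = (M₀ + ε) * C * x / Real.log x ^ k := by ring
    _ = (2 ^ k * (k.factorial : ℝ) + ε) * batemanHornConst f * (x : ℝ) / Real.log x ^ k := by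
        rw [hM₀, hCdef]

end PartB

end BatemanHornSelberg

end Literature.NumberTheory.Sieve
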